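import Literature.AlgebraicGeometry.Motives.HodgeThetaSubalgebraUnitaryCoprimeCore
import HarnessLib

/-!
# The `Θ`-subalgebra theorem for unitary multiplicities `(2, b)`, `b` odd — complex Hermitian core: an irreducible bracket-closed `𝔊 ∋ Θ`, stable under the adjoint of a Hermitian form definite on the two `Θ`-eigenspaces (dimensions `2` and `b` odd), is `End(W)` (Ribet 1983 Thm. 3 at multiplicities `(2, n−2)`, Lie step, classification-free)

Family `hodge`, layer `Literature/AlgebraicGeometry/Motives` (pure complex linear algebra; no geometry). Research context:
cell `pub-hodge-ring2` (HONEST FRAMING: research route conditional on HC_CM; not a corollary; Q11.4-sentence-2 already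
refuted in dim ≥ 3), Literature lane (lit gen 83, programme R61). UNCONDITIONAL; theorems only — no definition, no named
fact (D-0026), no `sorry`. It extends the tree's `(2,3)` core `UnitaryThetaCore.eq_top_two_three'`
(`Motives/HodgeThetaSubalgebraUnitaryCoprimeCore`, lit gen 66) to `(2, b)` for EVERY odd `b`, at the price of one extra
structure which the Hodge-theoretic application always supplies: the HERMITIAN FORM `h(x, y) = i·ψ_ℂ(x, conj y)` of the
polarization (Deligne, LNM 900, I §3: `ad C` is a Cartan involution; second Hodge–Riemann relation), definite on `W^{1,0}`
and on `W^{0,1}`, for which `𝔤_ℂ|_W` is closed under adjoints.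

THE PRINT. K. A. Ribet, Amer. J. Math. 105 (1983), Thm. 3 (Gordon's survey, Thm. 6.3 (3) and its proof sketch pp. 18–19:
«`End⁰(A) = K` imaginary quadratic, multiplicities `n'`, `n''` relatively prime ⟹ `Hg(A) = U_K(V,ψ)` … the induced map
`MT(A, ℂ) → GL(W')` is surjective … it is here that the relative primality of `n'` and `n''` is required» — Ribet invokes
a Lie-algebra lemma of Serre for this step). Here: `(n', n'') = (2, b)` or `(b, 2)` with `b` odd, i.e. `dim A = b + 2` odd
and `k` acting with multiplicities `(2, dim A − 2)`.

SETTING (complex, abstract; conventions of `UnitaryThetaCore`). `W` a finite-dimensional complex vector space;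
`𝔊 ⊆ End(W)` a `ℂ`-subspace closed under the commutator and acting irreducibly; `Θ ∈ 𝔊` an involution with eigenspaces
`P = {Θ = 1}` (`dim P = 2`) and `Q = {Θ = −1}` (`dim Q = b`); RAISING `B` (`ΘB = B = −BΘ`), LOWERING `C`
(`ΘC = −C = −CΘ`). HERMITIAN DATA: a function `s : W → W → ℂ`, additive and homogeneous in the first variable, Hermitian
(`s y x = conj (s x y)`), with `s(P, Q) = 0`, `s(x, x) ≠ 0` for `0 ≠ x ∈ P` and for `0 ≠ x ∈ Q`, such that every `X ∈ 𝔊`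
has an `s`-adjoint in `𝔊`.

WHAT IS PROVED (the architecture mirrors Ribet's/Serre's step «surjectivity onto `GL(W)`», replacing the minuscule-weight
classification by an induction on `b`).
* §0 rank-one operators `φ.smulRight u = u ⊗ φ`: products and commutators.
* §1 **`UnitaryTwoOdd.exists_rankOne_of_adStable`** — an `ad(End W)`-stable subspace `𝔑 ⊆ End(W)` containing an
  idempotent `f ≠ 0, 1` contains a rank-one idempotent (explicit brackets against `f = Σ uᵢ ⊗ βᵢ`).
* §2 **`UnitaryTwoOdd.exists_raise_onto`** — (`dim P = 2`, `dim Q ≥ 2`) an irreducible `𝔊 ∋ Θ` has a raising operator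
  mapping ONTO `P` (a space of rank-`≤ 1` operators shares an image line or a kernel hyperplane; both contradict the
  covering facts `UnitaryThetaCore.mem_span_raise_apply` / `eq_zero_of_forall_raise_apply_eq_zero`).
* §3 adjoints: the `s`-adjoint of a raising `B` is a lowering `C ∈ 𝔊`, and `BC|_P` is injective as soon as `B` maps onto
  `P` (positivity) — a FULL-RANK PAIR (`UnitaryTwoOdd.exists_fullRank_pair`).
* §4 **`UnitaryTwoOdd.exists_idempotent_of_fullRank_pair`** — the Cayley–Hamilton element
  `E = −Θ − δ⁻¹(χ(BC) − χ(CB)) ∈ 𝔊` (verbatim the tree's `(a, a+1)` construction, now for any `dim Q ≥ dim P`): `E|_P = 0`,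
  `E(W) ⊆ K := Q ∩ ker(CB)`, `E|_K = 1`, `Q = K ⊕ C(P)`, `dim C(P) = dim P`.
* §5 the Levi restriction algebra `𝔩_Q = {Z|_Q : Z ∈ 𝔊, ZΘ = ΘZ} ⊆ End(Q)`: bracket-closed, `Q` is `𝔩_Q`-irreducible,
  adjoint-closed for `s|_Q`; and the `𝔑`-TRICK: if `𝔩_Q = End(Q)` and `𝔊 ∋ F` with `F|_P = 0`, `F|_Q = f` an idempotent
  `≠ 0, 1`, then `𝔊` contains a rank-one idempotent (`[Z_A, F] = 0 ⊕ [A, f]`, §1).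
* §6 **`UnitaryTwoOdd.eq_top_of_rankOne`** — the rank-one criterion `SymplecticThetaSix.eq_top_of_rankOne_idempotent`
  without the hypothesis `1 ∈ 𝔊` (the `𝔊 + ℂ1` device of `eq_top_two_three'`); **`UnitaryTwoOdd.eq_top`** — THE THEOREM:
  `dim P = 2`, `dim Q = b` odd ⟹ `𝔊 = End(W)`, by strong induction on `b`. For `b = 1` a raising `B` with `B(Q) ≠ 0`
  and its adjoint are a full-rank pair for `−Θ` (multiplicities `(1, 2)`), and the tree's
  `UnitaryThetaCore.exists_rankOne_idempotent'` applies. For `b ≥ 3`: §2–§4 give `E`; the Levi algebra `𝔩_Q` contains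
  the involution `1_Q − 2E|_Q` with eigenspaces `C(P)` (dim `2`) and `K` (dim `b − 2`, odd), `C(P) ⊥ K`, and inherits the
  Hermitian data, so `𝔩_Q = End(Q)` by induction; the `𝔑`-trick of §5 then yields a rank-one idempotent in `𝔊`.
  **`UnitaryTwoOdd.eq_top'`** — the symmetric statement `dim P` odd, `dim Q = 2`.

## References
* [Ribet1983] K. A. Ribet, *Hodge classes on certain types of abelian varieties*, Amer. J. Math. 105 (1983), Thm. 3.
* [Gordon1997] B. B. Gordon, *A survey of the Hodge conjecture for abelian varieties*, Thm. 6.3 (3) and pp. 18–19.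
* [Deligne1982HodgeCycles] P. Deligne, *Hodge cycles on abelian varieties*, LNM 900 (1982), I §3 (Prop. 3.4, 3.6: the
  polarization form `ψ(x, C ȳ)` is positive definite; `ad C` is a Cartan involution of `Lie Hg_ℝ`).
* [MoonenZarhin1999LowDim] B. Moonen, Yu. Zarhin, Math. Ann. 315 (1999), §2 (2.4) and Thm. (2.7).
* [GoodmanWallachGTM255] R. Goodman, N. Wallach, *Symmetry, Representations, and Invariants*, §4.1.1 (gradings).
* [Humphreys1972] J. E. Humphreys, *Introduction to Lie Algebras and Representation Theory*, §19.1.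
* [HoffmanKunze1971LinearAlgebra] K. Hoffman, R. Kunze, *Linear Algebra*, §8.5, §9.5 (adjoints, positive operators).
-/

noncomputable section

open Module Polynomial

namespace Literature.AlgebraicGeometry.Motives

namespace HodgeStructure

/-! ### §0 Rank-one operators -/

section RankOneOps

variable {W : Type*} [AddCommGroup W] [Module ℂ W]

/-- `(u ⊗ α)(y ⊗ β) = α(y)·(u ⊗ β)` for the rank-one operators `α.smulRight u : w ↦ α(w)u`. [cite: Humphreys1972, §19.1] -/
theorem UnitaryTwoOdd.smulRight_mul_smulRight (α β : Module.Dual ℂ W) (u y : W) :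
    α.smulRight u * β.smulRight y = α y • β.smulRight u := by
  refine LinearMap.ext fun w => ?_
  simp only [Module.End.mul_apply, LinearMap.smulRight_apply, map_smul, LinearMap.smul_apply, smul_smul, mul_comm]

/-- `[u ⊗ α, y ⊗ β] = α(y)·(u ⊗ β) − β(u)·(y ⊗ α)`. [cite: Humphreys1972, §19.1] -/
theorem UnitaryTwoOdd.smulRight_comm_smulRight (α β : Module.Dual ℂ W) (u y : W) :
    α.smulRight u * β.smulRight y - β.smulRight y * α.smulRight u = α y • β.smulRight u - β u • α.smulRight y := by
  rw [UnitaryTwoOdd.smulRight_mul_smulRight, UnitaryTwoOdd.smulRight_mul_smulRight]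

/-- `A ∘ (u ⊗ α) = (A u) ⊗ α`. [cite: Humphreys1972, §19.1] -/
theorem UnitaryTwoOdd.mul_smulRight (A : Module.End ℂ W) (α : Module.Dual ℂ W) (u : W) :
    A * α.smulRight u = α.smulRight (A u) := by
  refine LinearMap.ext fun w => ?_
  rw [Module.End.mul_apply, LinearMap.smulRight_apply, LinearMap.smulRight_apply, map_smul]

/-- `(u ⊗ α) ∘ A = u ⊗ (α ∘ A)`. [cite: Humphreys1972, §19.1] -/
theorem UnitaryTwoOdd.smulRight_mul (A : Module.End ℂ W) (α : Module.Dual ℂ W) (u : W) :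
    α.smulRight u * A = (α ∘ₗ A).smulRight u := by
  refine LinearMap.ext fun w => ?_
  rw [Module.End.mul_apply, LinearMap.smulRight_apply, LinearMap.smulRight_apply, LinearMap.comp_apply]

/-- In a subspace of dimension `≤ 1` every vector is a multiple of any non-zero vector. [cite: HoffmanKunze1971LinearAlgebra, §2.3] -/
theorem UnitaryTwoOdd.mem_span_of_finrank_le_one [FiniteDimensional ℂ W] {S : Submodule ℂ W}
    (hS : Module.finrank ℂ S ≤ 1) {y z : W} (hy : y ∈ S) (hz : z ∈ S) (hy0 : y ≠ 0) : z ∈ ℂ ∙ y := by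
  have hle : (ℂ ∙ y) ≤ S := (Submodule.span_singleton_le_iff_mem y S).2 hy
  have h1 : Module.finrank ℂ (ℂ ∙ y) = 1 := finrank_span_singleton hy0
  have heq : (ℂ ∙ y) = S := Submodule.eq_of_le_of_finrank_le hle (by rw [h1]; exact hS)
  rw [heq]; exact hz

end RankOneOps

/-! ### §1 An `ad`-stable subspace containing a proper idempotent contains a rank-one idempotent -/

section AdStable

variable {W : Type*} [AddCommGroup W] [Module ℂ W]

/-- **An `ad(End W)`-stable subspace `𝔑 ⊆ End(W)` (`[A, Y] ∈ 𝔑` for all `A ∈ End(W)`, `Y ∈ 𝔑`) containing an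
idempotent `f ≠ 0, 1` contains a rank-one idempotent `u ⊗ φ`, `φ(u) = 1`.** Write `f = Σᵢ uᵢ ⊗ βᵢ` along a basis `uᵢ`
of `f(W)` (`βᵢ = uᵢ^* ∘ f`), pick `0 ≠ v ∈ ker f` and `γ` with `γ(v) = 1`, `γ(f W) = 0`; then successively
`v ⊗ βᵢ = [v ⊗ βᵢ, f]`, `uᵢ ⊗ βᵢ − v ⊗ γ = [uᵢ ⊗ γ, v ⊗ βᵢ]`, `u₀ ⊗ βᵢ = [u₀ ⊗ βᵢ, uᵢ ⊗ βᵢ − v ⊗ γ]` (`i ≠ 0`),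
`uᵢ ⊗ βᵢ − u₀ ⊗ β₀ = [uᵢ ⊗ β₀, u₀ ⊗ βᵢ]` lie in `𝔑`, and `f − Σ_{i ≠ 0}(uᵢ ⊗ βᵢ − u₀ ⊗ β₀) = r·(u₀ ⊗ β₀)`,
`r = rank f`. (The ideal structure of `𝔤𝔩(W)`.) [cite: Humphreys1972, §19.1 and §4.1] -/
theorem UnitaryTwoOdd.exists_rankOne_of_adStable [FiniteDimensional ℂ W] (𝔑 : Submodule ℂ (Module.End ℂ W))
    (had : ∀ A : Module.End ℂ W, ∀ Y ∈ 𝔑, A * Y - Y * A ∈ 𝔑) {f : Module.End ℂ W} (hf : f ∈ 𝔑)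
    (hff : f * f = f) (hf0 : f ≠ 0) (hf1 : f ≠ 1) :
    ∃ (u : W) (φ : Module.Dual ℂ W), φ u = 1 ∧ φ.smulRight u ∈ 𝔑 := by
  classical
  have hffv : ∀ w, f (f w) = f w := fun w => by rw [← Module.End.mul_apply, hff]
  -- a basis of `K = f(W)` and the dual functionals `βᵢ = uᵢ^* ∘ f`
  set K : Submodule ℂ W := LinearMap.range f with hKdef
  set r : ℕ := Module.finrank ℂ K with hrdef
  let b : Module.Basis (Fin r) ℂ K := Module.finBasisOfFinrankEq ℂ K rfl
  let u : Fin r → W := fun i => (b i : W)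
  let β : Fin r → Module.Dual ℂ W := fun i => (b.coord i) ∘ₗ f.rangeRestrict
  have hfu : ∀ i, f (u i) = u i := fun i => by
    obtain ⟨w, hw⟩ := LinearMap.mem_range.1 (b i).2
    change f (b i : W) = b i
    rw [← hw, hffv]
  have hrr : ∀ i, f.rangeRestrict (u i) = b i := fun i => by
    apply Subtype.ext
    change f (u i) = (b i : W)
    exact hfu i
  have hβu : ∀ i j, β i (u j) = if i = j then 1 else 0 := fun i j => by
    change b.coord i (f.rangeRestrict (u j)) = _
    rw [hrr, Module.Basis.coord_apply, b.repr_self, Finsupp.single_apply]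
    simp only [eq_comm]
  have hβf : ∀ i, β i ∘ₗ f = β i := fun i => by
    refine LinearMap.ext fun w => ?_
    have hfr : f.rangeRestrict (f w) = f.rangeRestrict w := Subtype.ext (by
      change f (f w) = f w
      exact hffv w)
    change b.coord i (f.rangeRestrict (f w)) = b.coord i (f.rangeRestrict w)
    rw [hfr]
  have hβker : ∀ i w, f w = 0 → β i w = 0 := fun i w hw => by
    have hfr : f.rangeRestrict w = 0 := Subtype.ext (by change f w = 0; exact hw)
    change b.coord i (f.rangeRestrict w) = 0
    rw [hfr, map_zero]
  have hfsum : f = ∑ i, (β i).smulRight (u i) := by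
    refine LinearMap.ext fun w => ?_
    rw [LinearMap.sum_apply]
    simp only [LinearMap.smulRight_apply]
    have h := b.sum_repr (f.rangeRestrict w)
    have h' := congrArg Subtype.val h
    rw [Submodule.coe_sum] at h'
    simp only [Submodule.coe_smul] at h'
    change (∑ i, b.repr (f.rangeRestrict w) i • u i) = f w at h'
    rw [← h']
    rfl
  -- `r ≥ 1`
  have hr : 0 < r := by
    rw [hrdef]
    by_contra h
    have h0 : Module.finrank ℂ K = 0 := by omega
    rw [Submodule.finrank_eq_zero, hKdef, LinearMap.range_eq_bot] at h0
    exact hf0 h0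
  set i₀ : Fin r := ⟨0, hr⟩ with hi₀
  -- a kernel vector `v` and a functional `γ` with `γ v = 1`, `γ (u i) = 0`
  obtain ⟨v, hv0, hfv⟩ : ∃ v : W, v ≠ 0 ∧ f v = 0 := by
    by_contra hne
    push Not at hne
    apply hf1
    refine LinearMap.ext fun w => ?_
    rw [Module.End.one_apply]
    have h : f (w - f w) = 0 := by rw [map_sub, hffv, sub_self]
    by_contra hw
    exact hne (w - f w) (sub_ne_zero.2 (Ne.symm hw)) h
  obtain ⟨γ₀, hγ₀⟩ := Module.Projective.exists_dual_eq_one ℂ hv0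
  set γ : Module.Dual ℂ W := γ₀ ∘ₗ (1 - f) with hγdef
  have hγv : γ v = 1 := by
    rw [hγdef, LinearMap.comp_apply, LinearMap.sub_apply, Module.End.one_apply, hfv, sub_zero, hγ₀]
  have hγu : ∀ i, γ (u i) = 0 := fun i => by
    rw [hγdef, LinearMap.comp_apply, LinearMap.sub_apply, Module.End.one_apply, hfu, sub_self, map_zero]
  have hβv : ∀ i, β i v = 0 := fun i => hβker i v hfv
  -- Step 1: `v ⊗ βᵢ ∈ 𝔑`
  have h1 : ∀ i, (β i).smulRight v ∈ 𝔑 := fun i => by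
    have h := had ((β i).smulRight v) f hf
    rwa [UnitaryTwoOdd.smulRight_mul, hβf, UnitaryTwoOdd.mul_smulRight, hfv, LinearMap.smulRight_zero,
      sub_zero] at h
  -- Step 2: `uᵢ ⊗ βᵢ − v ⊗ γ ∈ 𝔑`
  have h2 : ∀ i, (β i).smulRight (u i) - γ.smulRight v ∈ 𝔑 := fun i => by
    have h := had (γ.smulRight (u i)) _ (h1 i)
    rwa [UnitaryTwoOdd.smulRight_comm_smulRight, hγv, one_smul, hβu, if_pos rfl, one_smul] at h
  -- Step 3: `u₀ ⊗ βᵢ ∈ 𝔑` for `i ≠ i₀`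
  have h3 : ∀ i, i ≠ i₀ → (β i).smulRight (u i₀) ∈ 𝔑 := fun i hi => by
    have h := had ((β i).smulRight (u i₀)) _ (h2 i)
    have e1 : (β i).smulRight (u i₀) * (β i).smulRight (u i) - (β i).smulRight (u i) * (β i).smulRight (u i₀)
        = (β i).smulRight (u i₀) := by
      rw [UnitaryTwoOdd.smulRight_comm_smulRight, hβu, if_pos rfl, one_smul, hβu, if_neg hi, zero_smul, sub_zero]
    have e2 : (β i).smulRight (u i₀) * γ.smulRight v - γ.smulRight v * (β i).smulRight (u i₀) = 0 := by
      rw [UnitaryTwoOdd.smulRight_comm_smulRight, hβv, zero_smul, hγu, zero_smul, sub_zero]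
    have e : (β i).smulRight (u i₀) * ((β i).smulRight (u i) - γ.smulRight v) -
        ((β i).smulRight (u i) - γ.smulRight v) * (β i).smulRight (u i₀) =
        ((β i).smulRight (u i₀) * (β i).smulRight (u i) - (β i).smulRight (u i) * (β i).smulRight (u i₀)) -
        ((β i).smulRight (u i₀) * γ.smulRight v - γ.smulRight v * (β i).smulRight (u i₀)) := by
      rw [mul_sub, sub_mul]; abel
    rwa [e, e1, e2, sub_zero] at h
  -- Step 4: `uᵢ ⊗ βᵢ − u₀ ⊗ β₀ ∈ 𝔑` for `i ≠ i₀`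
  have h4 : ∀ i, i ≠ i₀ → (β i).smulRight (u i) - (β i₀).smulRight (u i₀) ∈ 𝔑 := fun i hi => by
    have h := had ((β i₀).smulRight (u i)) _ (h3 i hi)
    rwa [UnitaryTwoOdd.smulRight_comm_smulRight, hβu, if_pos rfl, one_smul, hβu, if_pos rfl, one_smul] at h
  -- Step 5: `f − Σ_{i ≠ i₀} (uᵢ ⊗ βᵢ − u₀ ⊗ β₀) = r·(u₀ ⊗ β₀)`
  have hmem : f - ∑ i ∈ Finset.univ.erase i₀, ((β i).smulRight (u i) - (β i₀).smulRight (u i₀)) ∈ 𝔑 :=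
    Submodule.sub_mem _ hf (Submodule.sum_mem _ fun i hi => h4 i (Finset.ne_of_mem_erase hi))
  have heq : f - ∑ i ∈ Finset.univ.erase i₀, ((β i).smulRight (u i) - (β i₀).smulRight (u i₀)) =
      (r : ℂ) • (β i₀).smulRight (u i₀) := by
    rw [Finset.sum_sub_distrib, Finset.sum_const, Finset.card_erase_of_mem (Finset.mem_univ _),
      Finset.card_univ, Fintype.card_fin, hfsum, ← Finset.add_sum_erase _ _ (Finset.mem_univ i₀)]
    have hr1 : ((r - 1 : ℕ) : ℂ) = (r : ℂ) - 1 := by rw [Nat.cast_sub hr, Nat.cast_one]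
    rw [← Nat.cast_smul_eq_nsmul ℂ, hr1]
    module
  rw [heq] at hmem
  have hr0 : (r : ℂ) ≠ 0 := Nat.cast_ne_zero.2 hr.ne'
  refine ⟨u i₀, β i₀, ?_, (Submodule.smul_mem_iff _ hr0).1 hmem⟩
  rw [hβu, if_pos rfl]

end AdStable

/-! ### §2 A raising operator onto `P` (`dim P = 2`) -/

section RaiseOnto

variable {W : Type*} [AddCommGroup W] [Module ℂ W]

/-- If `B` has values on the line `ℂx`, `B'` on the line `ℂx'` with `x' ∉ ℂx`, `B + B'` has rank `≤ 1` (any two of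
its values, the first non-zero, are proportional) and `B' ≠ 0`, then `ker B' ⊆ ker B`.
[cite: HoffmanKunze1971LinearAlgebra, §3.1] -/
theorem UnitaryTwoOdd.apply_eq_zero_of_rank_le_one {B B' : Module.End ℂ W} {x x' : W}
    (hB : ∀ w, B w ∈ ℂ ∙ x) (hB' : ∀ w, B' w ∈ ℂ ∙ x') (hx : x' ∉ ℂ ∙ x)
    (hsum : ∀ w₁ w₂, (B + B') w₁ ≠ 0 → (B + B') w₂ ∈ ℂ ∙ ((B + B') w₁))
    {w' : W} (hw' : B' w' ≠ 0) {w : W} (hw : B' w = 0) : B w = 0 := by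
  by_contra hBw
  obtain ⟨c, hc⟩ := Submodule.mem_span_singleton.1 (hB w)
  obtain ⟨c', hc'⟩ := Submodule.mem_span_singleton.1 (hB w')
  obtain ⟨d, hd⟩ := Submodule.mem_span_singleton.1 (hB' w')
  have hd0 : d ≠ 0 := fun h => hw' (by rw [← hd, h, zero_smul])
  have h1 : (B + B') w = c • x := by rw [LinearMap.add_apply, hw, add_zero, hc]
  have h1ne : (B + B') w ≠ 0 := by rw [LinearMap.add_apply, hw, add_zero]; exact hBw
  have h2 : (B + B') w' = c' • x + d • x' := by rw [LinearMap.add_apply, hc', hd]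
  obtain ⟨t, ht⟩ := Submodule.mem_span_singleton.1 (hsum w w' h1ne)
  rw [h1, h2, smul_smul] at ht
  have hx' : x' = d⁻¹ • ((t * c - c') • x) := by
    rw [sub_smul, ht, add_sub_cancel_left, smul_smul, inv_mul_cancel₀ hd0, one_smul]
  exact hx (by rw [hx']; exact Submodule.smul_mem _ _ (Submodule.smul_mem _ _ (Submodule.mem_span_singleton_self x)))

/-- **An irreducible `𝔊 ∋ Θ` with `dim P = 2`, `dim Q ≥ 2` has a raising operator mapping ONTO `P`.** Otherwise every
raising operator has rank `≤ 1`; two of them with independent image lines have a common kernel (previous lemma, the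
sum being again raising of rank `≤ 1`), so ALL raising operators kill one hyperplane `H ⊇ P`, and `H ∩ Q ≠ 0`
contradicts the covering fact that no non-zero vector of `Q` is killed by every raising operator
(`UnitaryThetaCore.eq_zero_of_forall_raise_apply_eq_zero`; the values of the raising operators span `P` by
`UnitaryThetaCore.mem_span_raise_apply`). [cite: Gordon1997, §6 (proof of Thm. 6.3.3, p. 19)] [cite: Ribet1983, Thm. 3] -/
theorem UnitaryTwoOdd.exists_raise_onto [FiniteDimensional ℂ W] {𝔊 : Submodule ℂ (Module.End ℂ W)}
    (hbr : ∀ Y ∈ 𝔊, ∀ Z ∈ 𝔊, Y * Z - Z * Y ∈ 𝔊)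
    (hirr : ∀ U : Submodule ℂ W, (∀ A ∈ 𝔊, ∀ u ∈ U, A u ∈ U) → U = ⊥ ∨ U = ⊤)
    {Θ : Module.End ℂ W} (hΘ : Θ ∈ 𝔊) (hΘΘ : Θ * Θ = 1)
    {P Q : Submodule ℂ W} (hP : ∀ x, x ∈ P ↔ Θ x = x) (hQ : ∀ x, x ∈ Q ↔ Θ x = -x)
    (hP2 : Module.finrank ℂ P = 2) (hQ2 : 2 ≤ Module.finrank ℂ Q) :
    ∃ B ∈ 𝔊, Θ * B = B ∧ B * Θ = -B ∧ ∀ p ∈ P, ∃ w, B w = p := by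
  classical
  have hΘΘv : ∀ v, Θ (Θ v) = v := fun v => by rw [← Module.End.mul_apply, hΘΘ, Module.End.one_apply]
  -- non-zero vectors in `P` and `Q`
  have hP0 : ∃ p : W, p ≠ 0 ∧ Θ p = p := by
    have hpos : 0 < Module.finrank ℂ P := by rw [hP2]; exact two_pos
    obtain ⟨⟨p, hp⟩, hp0⟩ := Module.finrank_pos_iff_exists_ne_zero.1 hpos
    exact ⟨p, fun h => hp0 (Subtype.ext h), (hP p).1 hp⟩
  have hQ0 : ∃ q : W, q ≠ 0 ∧ Θ q = -q := by
    have hpos : 0 < Module.finrank ℂ Q := by omega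
    obtain ⟨⟨q, hq⟩, hq0⟩ := Module.finrank_pos_iff_exists_ne_zero.1 hpos
    exact ⟨q, fun h => hq0 (Subtype.ext h), (hQ q).1 hq⟩
  by_contra hcon
  push Not at hcon
  -- every raising operator has values in `P` and rank `≤ 1`
  have hval : ∀ B, Θ * B = B → ∀ w, B w ∈ P := fun B hΘB w => (hP _).2 (by rw [← Module.End.mul_apply, hΘB])
  have hrank : ∀ B ∈ 𝔊, Θ * B = B → B * Θ = -B → Module.finrank ℂ (LinearMap.range B) ≤ 1 := by
    intro B hB hΘB hBΘ
    obtain ⟨p, hp, hpne⟩ := hcon B hB hΘB hBΘ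
    have hle : LinearMap.range B ≤ P := by rintro _ ⟨w, rfl⟩; exact hval B hΘB w
    have hlt : LinearMap.range B < P :=
      lt_of_le_of_ne hle fun h => by
        have : p ∈ LinearMap.range B := h ▸ hp
        obtain ⟨w, hw⟩ := this
        exact hpne w hw
    have := Submodule.finrank_lt_finrank_of_lt hlt
    omega
  have hline : ∀ B ∈ 𝔊, Θ * B = B → B * Θ = -B → ∀ w₀, B w₀ ≠ 0 → ∀ w, B w ∈ ℂ ∙ B w₀ :=
    fun B hB hΘB hBΘ w₀ hw₀ w => UnitaryTwoOdd.mem_span_of_finrank_le_one (hrank B hB hΘB hBΘ)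
      (LinearMap.mem_range_self B w₀) (LinearMap.mem_range_self B w) hw₀
  -- the raising predicate is closed under sums
  have hadd : ∀ B B', Θ * B = B → B * Θ = -B → Θ * B' = B' → B' * Θ = -B' →
      Θ * (B + B') = B + B' ∧ (B + B') * Θ = -(B + B') := fun B B' h1 h2 h3 h4 =>
    ⟨by rw [mul_add, h1, h3], by rw [add_mul, h2, h4, neg_add]⟩
  -- the set of values of raising operators spans `P`
  set S : Set W := {x : W | ∃ B ∈ 𝔊, Θ * B = B ∧ B * Θ = -B ∧ ∃ w, B w = x} with hSdef
  have hspan : ∀ y, Θ y = y → y ∈ Submodule.span ℂ S := fun y hy =>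
    UnitaryThetaCore.mem_span_raise_apply hbr hirr hΘ hΘΘ hQ0 hy
  -- a first non-zero raising operator
  obtain ⟨B₁, hB₁, hΘB₁, hB₁Θ, w₁, hw₁⟩ : ∃ B₁ ∈ 𝔊, Θ * B₁ = B₁ ∧ B₁ * Θ = -B₁ ∧ ∃ w₁, B₁ w₁ ≠ 0 := by
    by_contra hne
    push Not at hne
    obtain ⟨p, hp0, hp⟩ := hP0
    have hS0 : Submodule.span ℂ S ≤ ⊥ := by
      rw [Submodule.span_le]
      rintro x ⟨B, hB, h1, h2, w, rfl⟩
      exact hne B hB h1 h2 w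
    exact hp0 ((Submodule.mem_bot ℂ).1 (hS0 (hspan p hp)))
  set x₁ := B₁ w₁ with hx₁def
  -- a second raising operator with a value off the line `ℂ x₁`
  obtain ⟨B₂, hB₂, hΘB₂, hB₂Θ, w₂, hw₂⟩ : ∃ B₂ ∈ 𝔊, Θ * B₂ = B₂ ∧ B₂ * Θ = -B₂ ∧ ∃ w₂, B₂ w₂ ∉ ℂ ∙ x₁ := by
    by_contra hne
    push Not at hne
    have hS1 : Submodule.span ℂ S ≤ ℂ ∙ x₁ := by
      rw [Submodule.span_le]
      rintro x ⟨B, hB, h1, h2, w, rfl⟩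
      exact hne B hB h1 h2 w
    have hPle : P ≤ ℂ ∙ x₁ := fun p hp => hS1 (hspan p ((hP p).1 hp))
    have h := Submodule.finrank_mono hPle
    rw [hP2, finrank_span_singleton hw₁] at h
    omega
  set x₂ := B₂ w₂ with hx₂def
  have hx₂0 : x₂ ≠ 0 := fun h => hw₂ (by rw [h]; exact Submodule.zero_mem _)
  have hx₁2 : x₁ ∉ ℂ ∙ x₂ := fun h => by
    obtain ⟨c, hc⟩ := Submodule.mem_span_singleton.1 h
    have hc0 : c ≠ 0 := fun h0 => hw₁ (by rw [← hc, h0, zero_smul])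
    exact hw₂ (Submodule.mem_span_singleton.2 ⟨c⁻¹, by rw [← hc, smul_smul, inv_mul_cancel₀ hc0, one_smul]⟩)
  -- kernels: `ker B₁ = ker B₂ =: H`, and every raising operator kills `H`
  have hsum' : ∀ B B', B ∈ 𝔊 → B' ∈ 𝔊 → Θ * B = B → B * Θ = -B → Θ * B' = B' → B' * Θ = -B' →
      ∀ v₁ v₂, (B + B') v₁ ≠ 0 → (B + B') v₂ ∈ ℂ ∙ ((B + B') v₁) := by
    intro B B' hB hB' h1 h2 h3 h4 v₁ v₂ hv₁
    obtain ⟨h5, h6⟩ := hadd B B' h1 h2 h3 h4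
    exact hline (B + B') (Submodule.add_mem _ hB hB') h5 h6 v₁ hv₁ v₂
  have hker12 : ∀ w, B₁ w = 0 → B₂ w = 0 := fun w hw =>
    UnitaryTwoOdd.apply_eq_zero_of_rank_le_one (x := x₂) (x' := x₁) (hline B₂ hB₂ hΘB₂ hB₂Θ w₂ hx₂0)
      (hline B₁ hB₁ hΘB₁ hB₁Θ w₁ hw₁) hx₁2 (hsum' B₂ B₁ hB₂ hB₁ hΘB₂ hB₂Θ hΘB₁ hB₁Θ) hw₁ hw
  have hkill : ∀ B ∈ 𝔊, Θ * B = B → B * Θ = -B → ∀ w, B₁ w = 0 → B w = 0 := by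
    intro B hB hΘB hBΘ w hw
    by_cases hB0 : B w = 0
    · exact hB0
    set x := B w with hxdef
    by_cases hx : x ∈ ℂ ∙ x₁
    · -- values on the line `ℂ x₁ = ℂ x`: compare with `B₂`
      have hxx₂ : x₂ ∉ ℂ ∙ x := fun h => by
        obtain ⟨c, hc⟩ := Submodule.mem_span_singleton.1 hx
        obtain ⟨c', hc'⟩ := Submodule.mem_span_singleton.1 h
        exact hw₂ (Submodule.mem_span_singleton.2 ⟨c' * c, by rw [← smul_smul, hc, hc']⟩)
      exact UnitaryTwoOdd.apply_eq_zero_of_rank_le_one (hline B hB hΘB hBΘ w hB0) (hline B₂ hB₂ hΘB₂ hB₂Θ w₂ hx₂0)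
        hxx₂ (hsum' B B₂ hB hB₂ hΘB hBΘ hΘB₂ hB₂Θ) hx₂0 (hker12 w hw)
    · -- values off the line `ℂ x₁`: compare with `B₁`
      have hxx₁ : x₁ ∉ ℂ ∙ x := fun h => by
        obtain ⟨c, hc⟩ := Submodule.mem_span_singleton.1 h
        have hc0 : c ≠ 0 := fun h0 => hw₁ (by rw [← hc, h0, zero_smul])
        exact hx (Submodule.mem_span_singleton.2 ⟨c⁻¹, by rw [← hc, smul_smul, inv_mul_cancel₀ hc0, one_smul]⟩)
      exact UnitaryTwoOdd.apply_eq_zero_of_rank_le_one (hline B hB hΘB hBΘ w hB0) (hline B₁ hB₁ hΘB₁ hB₁Θ w₁ hw₁)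
        hxx₁ (hsum' B B₁ hB hB₁ hΘB hBΘ hΘB₁ hB₁Θ) hw₁ hw
  -- `H ∩ Q ≠ 0`
  set H : Submodule ℂ W := LinearMap.ker B₁ with hHdef
  have hPQsup : P ⊔ Q = ⊤ := by
    rw [eq_top_iff]
    intro v _
    have hv : (2 : ℂ)⁻¹ • (v + Θ v) + (2 : ℂ)⁻¹ • (v - Θ v) = v := by module
    rw [← hv]
    refine Submodule.add_mem_sup ((hP _).2 ?_) ((hQ _).2 ?_)
    · rw [map_smul, map_add, hΘΘv, add_comm]
    · rw [map_smul, map_sub, hΘΘv, ← smul_neg, neg_sub]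
  have hPQinf : P ⊓ Q = ⊥ := by
    rw [eq_bot_iff]
    intro x hx
    rw [Submodule.mem_bot]
    have h1 := (hP x).1 hx.1
    rw [(hQ x).1 hx.2, neg_eq_iff_add_eq_zero, ← two_smul ℂ x, smul_eq_zero] at h1
    exact h1.resolve_left (two_ne_zero' ℂ)
  have hdimW : Module.finrank ℂ W = Module.finrank ℂ P + Module.finrank ℂ Q := by
    have h := Submodule.finrank_sup_add_finrank_inf_eq P Q
    rw [hPQsup, hPQinf, finrank_top, finrank_bot, add_zero] at h
    exact h
  have hdimH : Module.finrank ℂ W ≤ Module.finrank ℂ H + 1 := by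
    have h := LinearMap.finrank_range_add_finrank_ker B₁
    have h' := hrank B₁ hB₁ hΘB₁ hB₁Θ
    rw [hHdef]; omega
  have hHQ : ∃ q ∈ H ⊓ Q, q ≠ 0 := by
    by_contra hne
    push Not at hne
    have hbot : H ⊓ Q = ⊥ := by
      rw [eq_bot_iff]; intro x hx; rw [Submodule.mem_bot]; exact hne x hx
    have h := Submodule.finrank_sup_add_finrank_inf_eq H Q
    rw [hbot, finrank_bot, add_zero] at h
    have hle := Submodule.finrank_le (H ⊔ Q)
    omega
  obtain ⟨q, hq, hq0⟩ := hHQ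
  obtain ⟨hqH, hqQ⟩ := Submodule.mem_inf.1 hq
  exact hq0 (UnitaryThetaCore.eq_zero_of_forall_raise_apply_eq_zero hbr hirr hΘ hΘΘ hP0 ((hQ q).1 hqQ)
    fun B hB hΘB hBΘ => hkill B hB hΘB hBΘ q (LinearMap.mem_ker.1 hqH))

end RaiseOnto

/-! ### §3 Hermitian data: adjoints, positivity, full-rank pairs -/

section Hermitian

variable {W : Type*} [AddCommGroup W] [Module ℂ W]

omit [Module ℂ W] in
/-- Right-hand identities of a function additive-homogeneous on the left and Hermitian.
[cite: HoffmanKunze1971LinearAlgebra, §8.1] -/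
theorem UnitaryTwoOdd.herm_right {s : W → W → ℂ} (hadd : ∀ x y z, s (x + y) z = s x z + s y z)
    (hsymm : ∀ x y, s y x = starRingEnd ℂ (s x y)) :
    (∀ x y z, s x (y + z) = s x y + s x z) ∧ (∀ x, s x 0 = 0) ∧ (∀ z, s 0 z = 0) ∧
      (∀ x y, s x (-y) = -s x y) ∧ (∀ x y, s (-x) y = -s x y) ∧
      (∀ x y z, s x (y - z) = s x y - s x z) ∧ (∀ x y z, s (x - y) z = s x z - s y z) := by
  have h0l : ∀ z, s 0 z = 0 := fun z => by
    have h := hadd 0 0 z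
    rw [add_zero] at h
    have h2 : s 0 z + s 0 z = s 0 z + 0 := by rw [add_zero]; exact h.symm
    exact add_left_cancel h2
  have haddr : ∀ x y z, s x (y + z) = s x y + s x z := fun x y z => by
    rw [hsymm (y + z) x, hadd, map_add, ← hsymm y x, ← hsymm z x]
  have h0r : ∀ x, s x 0 = 0 := fun x => by rw [hsymm 0 x, h0l, map_zero]
  have hnegl : ∀ x y, s (-x) y = -s x y := fun x y => by
    have h := hadd x (-x) y
    rw [add_neg_cancel, h0l] at h
    exact (neg_eq_of_add_eq_zero_right h.symm).symm
  have hnegr : ∀ x y, s x (-y) = -s x y := fun x y => by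
    rw [hsymm (-y) x, hnegl, map_neg, ← hsymm y x]
  refine ⟨haddr, h0r, h0l, hnegr, hnegl, fun x y z => ?_, fun x y z => ?_⟩
  · rw [sub_eq_add_neg, haddr, hnegr, ← sub_eq_add_neg]
  · rw [sub_eq_add_neg, hadd, hnegl, ← sub_eq_add_neg]

/-- **Non-degeneracy**: a vector right-orthogonal to everything is `0` (`s` Hermitian, `P ⊥ Q`, `s` definite on `P` and
on `Q`, `W = P ⊕ Q`). [cite: HoffmanKunze1971LinearAlgebra, §8.1] [cite: Deligne1982HodgeCycles, I §3 (proof of Prop. 3.4)] -/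
theorem UnitaryTwoOdd.eq_zero_of_forall_left {s : W → W → ℂ} (hadd : ∀ x y z, s (x + y) z = s x z + s y z)
    (hsymm : ∀ x y, s y x = starRingEnd ℂ (s x y)) {Θ : Module.End ℂ W} (hΘΘ : Θ * Θ = 1)
    {P Q : Submodule ℂ W} (hP : ∀ x, x ∈ P ↔ Θ x = x) (hQ : ∀ x, x ∈ Q ↔ Θ x = -x)
    (hPQ : ∀ p ∈ P, ∀ q ∈ Q, s p q = 0) (hdefP : ∀ p ∈ P, s p p = 0 → p = 0)
    (hdefQ : ∀ q ∈ Q, s q q = 0 → q = 0) {y : W} (hy : ∀ x, s x y = 0) : y = 0 := by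
  obtain ⟨haddr, -, -, -, -, -, -⟩ := UnitaryTwoOdd.herm_right hadd hsymm
  have hΘΘv : ∀ v, Θ (Θ v) = v := fun v => by rw [← Module.End.mul_apply, hΘΘ, Module.End.one_apply]
  have hp : (2 : ℂ)⁻¹ • (y + Θ y) ∈ P := (hP _).2 (by rw [map_smul, map_add, hΘΘv, add_comm])
  have hq : (2 : ℂ)⁻¹ • (y - Θ y) ∈ Q := (hQ _).2 (by rw [map_smul, map_sub, hΘΘv, ← smul_neg, neg_sub])
  have hsplit : (2 : ℂ)⁻¹ • (y + Θ y) + (2 : ℂ)⁻¹ • (y - Θ y) = y := by module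
  set p := (2 : ℂ)⁻¹ • (y + Θ y)
  set q := (2 : ℂ)⁻¹ • (y - Θ y)
  have h1 := hy p
  rw [← hsplit, haddr, hPQ p hp q hq, add_zero] at h1
  have h2 := hy q
  rw [← hsplit, haddr, hsymm, hPQ p hp q hq, map_zero, zero_add] at h2
  rw [← hsplit, hdefP p hp h1, hdefQ q hq h2, add_zero]

/-- **`Θ` is self-adjoint**: `s(Θx, y) = s(x, Θy)` (`P ⊥ Q`, `s` Hermitian).
[cite: Deligne1982HodgeCycles, I §3 (proof of Prop. 3.4)] -/
theorem UnitaryTwoOdd.theta_selfAdjoint {s : W → W → ℂ} (hadd : ∀ x y z, s (x + y) z = s x z + s y z)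
    (hsymm : ∀ x y, s y x = starRingEnd ℂ (s x y)) {Θ : Module.End ℂ W} (hΘΘ : Θ * Θ = 1)
    {P Q : Submodule ℂ W} (hP : ∀ x, x ∈ P ↔ Θ x = x) (hQ : ∀ x, x ∈ Q ↔ Θ x = -x)
    (hPQ : ∀ p ∈ P, ∀ q ∈ Q, s p q = 0) (x y : W) : s (Θ x) y = s x (Θ y) := by
  obtain ⟨haddr, -, -, -, -, hsubr, hsubl⟩ := UnitaryTwoOdd.herm_right hadd hsymm
  have hΘΘv : ∀ v, Θ (Θ v) = v := fun v => by rw [← Module.End.mul_apply, hΘΘ, Module.End.one_apply]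
  have hPhat : ∀ w, (2 : ℂ)⁻¹ • (w + Θ w) ∈ P := fun w => (hP _).2 (by rw [map_smul, map_add, hΘΘv, add_comm])
  have hQhat : ∀ w, (2 : ℂ)⁻¹ • (w - Θ w) ∈ Q := fun w =>
    (hQ _).2 (by rw [map_smul, map_sub, hΘΘv, ← smul_neg, neg_sub])
  have hsplit : ∀ w, (2 : ℂ)⁻¹ • (w + Θ w) + (2 : ℂ)⁻¹ • (w - Θ w) = w := fun w => by module
  have hΘsplit : ∀ w, Θ w = (2 : ℂ)⁻¹ • (w + Θ w) - (2 : ℂ)⁻¹ • (w - Θ w) := fun w => by module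
  set px := (2 : ℂ)⁻¹ • (x + Θ x)
  set qx := (2 : ℂ)⁻¹ • (x - Θ x)
  set py := (2 : ℂ)⁻¹ • (y + Θ y)
  set qy := (2 : ℂ)⁻¹ • (y - Θ y)
  have h1 : s px qy = 0 := hPQ _ (hPhat x) _ (hQhat y)
  have h2 : s qx py = 0 := by rw [hsymm, hPQ _ (hPhat y) _ (hQhat x), map_zero]
  calc s (Θ x) y = s (px - qx) (py + qy) := by rw [← hΘsplit x, hsplit y]
    _ = s px py + s px qy - (s qx py + s qx qy) := by rw [hsubl, haddr, haddr]
    _ = s px py - s px qy + (s qx py - s qx qy) := by rw [h1, h2]; ring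
    _ = s (px + qx) (py - qy) := by rw [hadd, hsubr, hsubr]
    _ = s x (Θ y) := by rw [hsplit x, ← hΘsplit y]

/-- **The adjoint of a raising operator is lowering.** [cite: Deligne1982HodgeCycles, I §3 (proof of Prop. 3.4, 3.6)]
[cite: HoffmanKunze1971LinearAlgebra, §8.5] -/
theorem UnitaryTwoOdd.lower_of_adjoint {s : W → W → ℂ} (hadd : ∀ x y z, s (x + y) z = s x z + s y z)
    (hsymm : ∀ x y, s y x = starRingEnd ℂ (s x y)) {Θ : Module.End ℂ W} (hΘΘ : Θ * Θ = 1)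
    {P Q : Submodule ℂ W} (hP : ∀ x, x ∈ P ↔ Θ x = x) (hQ : ∀ x, x ∈ Q ↔ Θ x = -x)
    (hPQ : ∀ p ∈ P, ∀ q ∈ Q, s p q = 0) (hdefP : ∀ p ∈ P, s p p = 0 → p = 0)
    (hdefQ : ∀ q ∈ Q, s q q = 0 → q = 0) {B C : Module.End ℂ W} (hΘB : Θ * B = B) (hBΘ : B * Θ = -B)
    (hBC : ∀ x y, s (B x) y = s x (C y)) : Θ * C = -C ∧ C * Θ = C := by
  obtain ⟨haddr, -, h0l, hnegr, -, hsubr, -⟩ := UnitaryTwoOdd.herm_right hadd hsymm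
  have hΘs := UnitaryTwoOdd.theta_selfAdjoint hadd hsymm hΘΘ hP hQ hPQ
  have hnd := fun y => UnitaryTwoOdd.eq_zero_of_forall_left hadd hsymm hΘΘ hP hQ hPQ hdefP hdefQ (y := y)
  constructor
  · refine LinearMap.ext fun y => ?_
    rw [LinearMap.neg_apply, ← sub_eq_zero, sub_neg_eq_add]
    refine hnd _ fun x => ?_
    have h : B (Θ x) + B x = 0 := by rw [← Module.End.mul_apply, hBΘ, LinearMap.neg_apply, neg_add_cancel]
    rw [haddr, Module.End.mul_apply, ← hΘs, ← hBC, ← hBC, ← hadd, h, h0l]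
  · refine LinearMap.ext fun y => ?_
    rw [← sub_eq_zero, ← LinearMap.sub_apply]
    refine hnd _ fun x => ?_
    rw [LinearMap.sub_apply, hsubr, Module.End.mul_apply, ← hBC, ← hΘs, ← Module.End.mul_apply, hΘB, hBC, sub_self]

/-- **Positivity: a raising operator ONTO `P` and its adjoint form a full-rank pair** (`BC|_P` injective: if
`B(Cp) = 0` then `s(Cp, Cp) = s(B C p, p) = 0`, so `Cp = 0`, so `p = Bw ⊥ P`, so `p = 0`).
[cite: Deligne1982HodgeCycles, I §3 (proof of Prop. 3.6)] [cite: HoffmanKunze1971LinearAlgebra, §9.5] -/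
theorem UnitaryTwoOdd.injOn_of_adjoint {s : W → W → ℂ} (hadd : ∀ x y z, s (x + y) z = s x z + s y z)
    (hsymm : ∀ x y, s y x = starRingEnd ℂ (s x y)) {Θ : Module.End ℂ W} (hΘΘ : Θ * Θ = 1)
    {P Q : Submodule ℂ W} (hP : ∀ x, x ∈ P ↔ Θ x = x) (hQ : ∀ x, x ∈ Q ↔ Θ x = -x)
    (hPQ : ∀ p ∈ P, ∀ q ∈ Q, s p q = 0) (hdefP : ∀ p ∈ P, s p p = 0 → p = 0)
    (hdefQ : ∀ q ∈ Q, s q q = 0 → q = 0) {B C : Module.End ℂ W} (hΘB : Θ * B = B) (hBΘ : B * Θ = -B)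
    (hBC : ∀ x y, s (B x) y = s x (C y)) (honto : ∀ p ∈ P, ∃ w, B w = p) :
    ∀ p ∈ P, B (C p) = 0 → p = 0 := by
  obtain ⟨-, h0r, h0l, -, -, -, -⟩ := UnitaryTwoOdd.herm_right hadd hsymm
  obtain ⟨hΘC, -⟩ := UnitaryTwoOdd.lower_of_adjoint hadd hsymm hΘΘ hP hQ hPQ hdefP hdefQ hΘB hBΘ hBC
  intro p hp hBCp
  have hCp : C p ∈ Q := (hQ _).2 (by rw [← Module.End.mul_apply, hΘC, LinearMap.neg_apply])
  have h1 : s (C p) (C p) = 0 := by rw [← hBC, hBCp, h0l]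
  have hCp0 : C p = 0 := hdefQ _ hCp h1
  obtain ⟨w, hw⟩ := honto p hp
  refine hdefP p hp ?_
  rw [← hw, hBC, hw, hCp0, h0r]

end Hermitian

/-! ### §4 The Cayley–Hamilton idempotent of a full-rank pair -/

section CayleyHamilton

variable {W : Type*} [AddCommGroup W] [Module ℂ W]

/-- `(CB)^k·C = C·(BC)^k`. [cite: GoodmanWallachGTM255, §4.1.1] -/
theorem UnitaryTwoOdd.pow_mul_eq_mul_pow (B C : Module.End ℂ W) (k : ℕ) :
    (C * B) ^ k * C = C * (B * C) ^ k := by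
  induction k with
  | zero => rw [pow_zero, pow_zero, one_mul, mul_one]
  | succ k ih =>
    rw [pow_succ, pow_succ, show (C * B) ^ k * (C * B) * C = ((C * B) ^ k * C) * (B * C) by noncomm_ring, ih,
      mul_assoc]

/-- `p(CB)·C = C·p(BC)`. [cite: GoodmanWallachGTM255, §4.1.1] -/
theorem UnitaryTwoOdd.aeval_mul_eq_mul_aeval (B C : Module.End ℂ W) (p : ℂ[X]) :
    aeval (C * B) p * C = C * aeval (B * C) p := by
  induction p using Polynomial.induction_on' with
  | add p q hp hq => rw [map_add, map_add, add_mul, mul_add, hp, hq]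
  | monomial k c =>
    simp only [aeval_monomial, Algebra.algebraMap_eq_smul_one, smul_mul_assoc, one_mul, mul_smul_comm,
      UnitaryTwoOdd.pow_mul_eq_mul_pow]

/-- **The Cayley–Hamilton idempotent of a full-rank pair** (the tree's `UnitaryThetaCore.exists_rankOne_idempotent'`
construction, for arbitrary `dim Q ≥ dim P`): for `𝔊 ∋ Θ` bracket-closed, `B ∈ 𝔊` raising, `C ∈ 𝔊` lowering with `BC|_P`
injective, the element `E = −Θ − δ⁻¹(χ(BC) − χ(CB)) ∈ 𝔊` (`χ` = characteristic polynomial of `BC|_P`, `δ = χ(0) ≠ 0`)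
vanishes on `P` and on `C(P)`, maps `W` into `K = Q ∩ ker(CB)` and is the identity on `K`; moreover `Q = K ⊕ C(P)` and
`dim C(P) = dim P`. [cite: Ribet1983, Thm. 3] [cite: Gordon1997, §6 (proof of Thm. 6.3.3, pp. 18–19)]
[cite: GoodmanWallachGTM255, §4.1.1] -/
theorem UnitaryTwoOdd.exists_idempotent_of_fullRank_pair [FiniteDimensional ℂ W]
    {𝔊 : Submodule ℂ (Module.End ℂ W)} (hbr : ∀ Y ∈ 𝔊, ∀ Z ∈ 𝔊, Y * Z - Z * Y ∈ 𝔊)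
    {Θ : Module.End ℂ W} (hΘ : Θ ∈ 𝔊) (hΘΘ : Θ * Θ = 1)
    {P Q : Submodule ℂ W} (hP : ∀ x, x ∈ P ↔ Θ x = x) (hQ : ∀ x, x ∈ Q ↔ Θ x = -x)
    {B C : Module.End ℂ W} (hB : B ∈ 𝔊) (hC : C ∈ 𝔊) (hΘB : Θ * B = B) (hBΘ : B * Θ = -B)
    (hΘC : Θ * C = -C) (hCΘ : C * Θ = C) (hinj : ∀ p ∈ P, B (C p) = 0 → p = 0) :
    ∃ E ∈ 𝔊, (∀ p ∈ P, E p = 0) ∧ (∀ w, E w ∈ Q ⊓ LinearMap.ker (C * B)) ∧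
      (∀ u ∈ Q ⊓ LinearMap.ker (C * B), E u = u) ∧ (∀ p ∈ P, E (C p) = 0) ∧
      (∀ q ∈ Q, E q = 0 → q ∈ P.map C) ∧
      Module.finrank ℂ ↥(P.map C) = Module.finrank ℂ P ∧
      (Q ⊓ LinearMap.ker (C * B)) ⊔ P.map C = Q ∧ (Q ⊓ LinearMap.ker (C * B)) ⊓ P.map C = ⊥ := by
  classical
  -- pointwise facts
  have hΘΘv : ∀ v, Θ (Θ v) = v := fun v => by rw [← Module.End.mul_apply, hΘΘ, Module.End.one_apply]
  have hBB : B * B = 0 := UnitaryThetaCore.mul_self_eq_zero_of_raise hΘB hBΘ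
  have hBP : ∀ p ∈ P, B p = 0 := fun p hp => by
    have h : B p = -(B p) := by
      conv_lhs => rw [← (hP p).1 hp]
      rw [← Module.End.mul_apply, hBΘ, LinearMap.neg_apply]
    have h2 : (2 : ℂ) • B p = 0 := by rw [two_smul]; nth_rewrite 2 [h]; rw [add_neg_cancel]
    exact (smul_eq_zero.1 h2).resolve_left two_ne_zero
  have hCQ : ∀ q ∈ Q, C q = 0 := fun q hq => by
    have h : C q = -(C q) := by
      conv_lhs => rw [← neg_neg q, ← (hQ q).1 hq, map_neg, ← Module.End.mul_apply, hCΘ]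
    have h2 : (2 : ℂ) • C q = 0 := by rw [two_smul]; nth_rewrite 2 [h]; rw [add_neg_cancel]
    exact (smul_eq_zero.1 h2).resolve_left two_ne_zero
  have hBmem : ∀ w, B w ∈ P := fun w => (hP _).2 (by rw [← Module.End.mul_apply, hΘB])
  have hCmem : ∀ w, C w ∈ Q := fun w => (hQ _).2 (by rw [← Module.End.mul_apply, hΘC, LinearMap.neg_apply])
  have hPhat : ∀ w, (2 : ℂ)⁻¹ • (w + Θ w) ∈ P := fun w =>
    (hP _).2 (by rw [map_smul, map_add, hΘΘv, add_comm])
  have hQhat : ∀ w, (2 : ℂ)⁻¹ • (w - Θ w) ∈ Q := fun w =>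
    (hQ _).2 (by rw [map_smul, map_sub, hΘΘv, ← smul_neg, neg_sub])
  have hsplit : ∀ w, (2 : ℂ)⁻¹ • (w + Θ w) + (2 : ℂ)⁻¹ • (w - Θ w) = w := fun w => by module
  -- the restricted operator `f = BC|_P`, its characteristic polynomial
  have hf : ∀ x ∈ P, (B * C) x ∈ P := fun x _ => hBmem _
  set f : Module.End ℂ P := (B * C).restrict hf with hfdef
  have hfinj : Function.Injective f := by
    intro x y hxy
    apply Subtype.ext
    have h : ((f x : P) : W) = (f y : W) := by rw [hxy]
    rw [hfdef, LinearMap.coe_restrict_apply, LinearMap.coe_restrict_apply, Module.End.mul_apply,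
      Module.End.mul_apply, ← sub_eq_zero, ← map_sub, ← map_sub] at h
    exact sub_eq_zero.1 (hinj _ (Submodule.sub_mem _ x.2 y.2) h)
  have hfunit : IsUnit f := (LinearMap.isUnit_iff_ker_eq_bot f).2 (LinearMap.ker_eq_bot.2 hfinj)
  set χ : ℂ[X] := f.charpoly with hχdef
  set δ : ℂ := χ.coeff 0 with hδdef
  have hδ : δ ≠ 0 := by
    intro h0
    have hdet : LinearMap.det f = 0 := by
      rw [LinearMap.det_eq_sign_charpoly_coeff, ← hχdef, ← hδdef, h0, mul_zero]
    have hu := (LinearMap.isUnit_iff_isUnit_det f).1 hfunit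
    rw [hdet] at hu
    exact not_isUnit_zero hu
  -- Cayley–Hamilton on `P`
  have hCH : ∀ p ∈ P, aeval (B * C) χ p = 0 := fun p hp => by
    have h := UnitaryThetaCore.aeval_restrict_coe hf χ ⟨p, hp⟩
    rw [hχdef, LinearMap.aeval_self_charpoly, LinearMap.zero_apply, Submodule.coe_zero] at h
    rw [hχdef, ← h]
  have hBCQ : ∀ q ∈ Q, (B * C) q = 0 := fun q hq => by rw [Module.End.mul_apply, hCQ q hq, map_zero]
  have hCBP : ∀ p ∈ P, (C * B) p = 0 := fun p hp => by rw [Module.End.mul_apply, hBP p hp, map_zero]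
  have haevalBC : aeval (B * C) χ = δ • ((2 : ℂ)⁻¹ • ((1 : Module.End ℂ W) - Θ)) := by
    refine LinearMap.ext fun w => ?_
    conv_lhs => rw [← hsplit w]
    rw [map_add, hCH _ (hPhat w), zero_add, UnitaryThetaCore.aeval_apply_of_apply_eq_zero _ _ (hBCQ _ (hQhat w))]
    simp only [LinearMap.smul_apply, LinearMap.sub_apply, Module.End.one_apply, hδdef]
  -- the element `E = −Θ − δ⁻¹ (χ(BC) − χ(CB))`
  set E : Module.End ℂ W := δ⁻¹ • aeval (C * B) χ - (2 : ℂ)⁻¹ • (1 + Θ) with hEdef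
  have hEmem : E ∈ 𝔊 := by
    have hEeq : E = -Θ - δ⁻¹ • (aeval (B * C) χ - aeval (C * B) χ) := by
      rw [hEdef, haevalBC, smul_sub, smul_smul, inv_mul_cancel₀ hδ, one_smul]
      module
    rw [hEeq]
    exact Submodule.sub_mem _ (Submodule.neg_mem _ hΘ)
      (Submodule.smul_mem _ _ (UnitaryThetaCore.aeval_sub_aeval_mem hbr hB hC hBB χ))
  have hEP : ∀ p ∈ P, E p = 0 := fun p hp => by
    rw [hEdef, LinearMap.sub_apply, LinearMap.smul_apply,
      UnitaryThetaCore.aeval_apply_of_apply_eq_zero _ _ (hCBP p hp), ← hδdef, smul_smul, inv_mul_cancel₀ hδ,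
      one_smul, LinearMap.smul_apply, LinearMap.add_apply, Module.End.one_apply, (hP p).1 hp]
    module
  have hEQ : ∀ q ∈ Q, E q = δ⁻¹ • aeval (C * B) χ q := fun q hq => by
    rw [hEdef, LinearMap.sub_apply, LinearMap.smul_apply, LinearMap.smul_apply, LinearMap.add_apply,
      Module.End.one_apply, (hQ q).1 hq, add_neg_cancel, smul_zero, sub_zero]
  -- `K = Q ∩ ker(CB)`; `E` maps `W` into `K` and is the identity on `K`
  set K : Submodule ℂ W := Q ⊓ LinearMap.ker (C * B) with hKdef
  have hΘCB : Θ * (C * B) = C * B * Θ := by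
    rw [← mul_assoc, hΘC, mul_assoc, hBΘ, neg_mul, mul_neg]
  have hEQmem : ∀ q ∈ Q, E q ∈ K := fun q hq => by
    rw [hEQ q hq]
    refine Submodule.smul_mem _ _ (Submodule.mem_inf.2 ⟨(hQ _).2 ?_, LinearMap.mem_ker.2 ?_⟩)
    · rw [← Module.End.mul_apply, UnitaryThetaCore.commute_aeval hΘCB, Module.End.mul_apply, (hQ q).1 hq, map_neg]
    · rw [← Module.End.mul_apply, UnitaryThetaCore.mul_aeval_eq, Module.End.mul_apply,
        Module.End.mul_apply, hCH _ (hBmem q), map_zero]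
  have hEW : ∀ w, E w ∈ K := fun w => by
    rw [← hsplit w, map_add, hEP _ (hPhat w), zero_add]
    exact hEQmem _ (hQhat w)
  have hEK : ∀ u ∈ K, E u = u := fun u hu => by
    have hu' := Submodule.mem_inf.1 hu
    rw [hEQ u hu'.1, UnitaryThetaCore.aeval_apply_of_apply_eq_zero _ _ (LinearMap.mem_ker.1 hu'.2), ← hδdef,
      smul_smul, inv_mul_cancel₀ hδ, one_smul]
  -- `E` kills `C(P)`
  have hECP : ∀ p ∈ P, E (C p) = 0 := fun p hp => by
    rw [hEQ _ (hCmem p), ← Module.End.mul_apply, UnitaryTwoOdd.aeval_mul_eq_mul_aeval, Module.End.mul_apply,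
      hCH p hp, map_zero, smul_zero]
  -- `Q = K ⊕ C(P)` and `dim C(P) = dim P`
  have hCinj : ∀ p ∈ P, C p = 0 → p = 0 := fun p hp h0 => hinj p hp (by rw [h0, map_zero])
  set g : P →ₗ[ℂ] W := C ∘ₗ P.subtype with hgdef
  have hginj : Function.Injective g := by
    intro x y hxy
    apply Subtype.ext
    have h : C (x - y : P) = 0 := by
      rw [Submodule.coe_sub, map_sub]; exact sub_eq_zero.2 hxy
    exact sub_eq_zero.1 (by exact_mod_cast hCinj _ (x - y).2 h)
  have hrange : LinearMap.range g = P.map C := by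
    rw [hgdef, LinearMap.range_comp, Submodule.range_subtype]
  have hfin_map : Module.finrank ℂ (P.map C) = Module.finrank ℂ P := by
    rw [← hrange, LinearMap.finrank_range_of_inj hginj]
  have hsup : K ⊔ P.map C = Q := by
    apply le_antisymm
    · refine sup_le (fun x hx => hx.1) ?_
      rintro _ ⟨p, -, rfl⟩
      exact hCmem p
    · intro q hq
      obtain ⟨p', hp'⟩ := (LinearMap.injective_iff_surjective.1 hfinj) ⟨B q, hBmem q⟩
      have hp'W : B (C (p' : W)) = B q := by
        have h := congrArg Subtype.val hp'
        rw [hfdef, LinearMap.coe_restrict_apply, Module.End.mul_apply] at h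
        exact h
      have hsplitq : q = (q - C p') + C p' := by abel
      rw [hsplitq]
      refine Submodule.add_mem _ (Submodule.mem_sup_left (Submodule.mem_inf.2
        ⟨Submodule.sub_mem _ hq (hCmem _), LinearMap.mem_ker.2 ?_⟩)) (Submodule.mem_sup_right ⟨p', p'.2, rfl⟩)
      rw [Module.End.mul_apply, map_sub, hp'W, sub_self, map_zero]
  have hinf : K ⊓ P.map C = ⊥ := by
    rw [eq_bot_iff]
    rintro x ⟨hxK, ⟨p, hp, rfl⟩⟩
    rw [Submodule.mem_bot]
    have h1' : B (C p) = 0 := by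
      have hk : C (B (C p)) = 0 := by
        have h := LinearMap.mem_ker.1 (Submodule.mem_inf.1 hxK).2
        rwa [Module.End.mul_apply] at h
      exact hCinj _ (hBmem _) hk
    rw [hinj p hp h1', map_zero]
  -- the kernel of `E` on `Q` is `C(P)`
  have hEker : ∀ q ∈ Q, E q = 0 → q ∈ P.map C := by
    intro q hq hEq
    rw [← hsup] at hq
    obtain ⟨k, hk, y, hy, rfl⟩ := Submodule.mem_sup.1 hq
    obtain ⟨p, hp, rfl⟩ := hy
    rw [map_add, hEK k hk, hECP p hp, add_zero] at hEq
    rw [hEq, zero_add]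
    exact ⟨p, hp, rfl⟩
  exact ⟨E, hEmem, hEP, hEW, hEK, hECP, hEker, hfin_map, hsup, hinf⟩

end CayleyHamilton

/-! ### §5 The Levi restriction algebra of `Q` -/

section Levi

variable {W : Type*} [AddCommGroup W] [Module ℂ W]

/-- **`Q` is irreducible under the restrictions to `Q` of the `Θ`-commuting elements of an irreducible `𝔊 ∋ Θ`.**
For an `𝔩_Q`-stable `U ⊆ Q`, the subspace `U ⊕ Σ_{B raising} B(U)` is `𝔊`-stable (grading `Z = Z₊ + Z₋ + Z₀`,
`[Z₀, B]` raising, `[Z₋, B]` commuting with `Θ`, raising operators kill `P`, lowering ones kill `Q`), hence `0` or `W`.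
[cite: GoodmanWallachGTM255, §4.1.1] [cite: Gordon1997, §6 (proof of Thm. 6.3.3, p. 19)] -/
theorem UnitaryTwoOdd.levi_irreducible {𝔊 : Submodule ℂ (Module.End ℂ W)}
    (hbr : ∀ Y ∈ 𝔊, ∀ Z ∈ 𝔊, Y * Z - Z * Y ∈ 𝔊)
    (hirr : ∀ U : Submodule ℂ W, (∀ A ∈ 𝔊, ∀ u ∈ U, A u ∈ U) → U = ⊥ ∨ U = ⊤)
    {Θ : Module.End ℂ W} (hΘ : Θ ∈ 𝔊) (hΘΘ : Θ * Θ = 1)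
    {P Q : Submodule ℂ W} (hP : ∀ x, x ∈ P ↔ Θ x = x) (hQ : ∀ x, x ∈ Q ↔ Θ x = -x)
    (𝔩 : Submodule ℂ (Module.End ℂ Q))
    (hres : ∀ Z ∈ 𝔊, Z * Θ = Θ * Z → ∃ A ∈ 𝔩, ∀ q : Q, ((A q : Q) : W) = Z q) :
    ∀ U : Submodule ℂ Q, (∀ A ∈ 𝔩, ∀ u ∈ U, A u ∈ U) → U = ⊥ ∨ U = ⊤ := by
  classical
  intro U hU
  have hΘΘv : ∀ v, Θ (Θ v) = v := fun v => by rw [← Module.End.mul_apply, hΘΘ, Module.End.one_apply]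
  -- raising operators kill `P`, lowering ones kill `Q`; values
  have hraiseP : ∀ Z : Module.End ℂ W, Z * Θ = -Z → ∀ p ∈ P, Z p = 0 := fun Z hZΘ p hp => by
    have h : Z p = -(Z p) := by
      conv_lhs => rw [← (hP p).1 hp]
      rw [← Module.End.mul_apply, hZΘ, LinearMap.neg_apply]
    have h2 : (2 : ℂ) • Z p = 0 := by rw [two_smul]; nth_rewrite 2 [h]; rw [add_neg_cancel]
    exact (smul_eq_zero.1 h2).resolve_left two_ne_zero
  have hlowerQ : ∀ Z : Module.End ℂ W, Z * Θ = Z → ∀ q ∈ Q, Z q = 0 := fun Z hZΘ q hq => by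
    have h : Z q = -(Z q) := by
      conv_lhs => rw [← neg_neg q, ← (hQ q).1 hq, map_neg, ← Module.End.mul_apply, hZΘ]
    have h2 : (2 : ℂ) • Z q = 0 := by rw [two_smul]; nth_rewrite 2 [h]; rw [add_neg_cancel]
    exact (smul_eq_zero.1 h2).resolve_left two_ne_zero
  have hraiseval : ∀ Z : Module.End ℂ W, Θ * Z = Z → ∀ w, Z w ∈ P := fun Z hΘZ w =>
    (hP _).2 (by rw [← Module.End.mul_apply, hΘZ])
  have hcommQ : ∀ Z : Module.End ℂ W, Z * Θ = Θ * Z → ∀ q ∈ Q, Z q ∈ Q := fun Z hZ q hq =>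
    (hQ _).2 (by rw [← Module.End.mul_apply, ← hZ, Module.End.mul_apply, (hQ q).1 hq, map_neg])
  -- the subspaces `U' = U ⊆ W`, `V₀ = Σ B(U')`, `M = U' + V₀`
  set U' : Submodule ℂ W := U.map Q.subtype with hU'def
  have hU'Q : U' ≤ Q := Submodule.map_subtype_le Q U
  have hU'mem : ∀ x, x ∈ U' ↔ ∃ u ∈ U, (u : W) = x := fun x => by
    rw [hU'def, Submodule.mem_map]; rfl
  set S : Set W := {x : W | ∃ Z ∈ 𝔊, Θ * Z = Z ∧ Z * Θ = -Z ∧ ∃ u ∈ U', Z u = x} with hSdef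
  set V₀ : Submodule ℂ W := Submodule.span ℂ S with hV₀def
  have hV₀P : V₀ ≤ P := by
    rw [hV₀def, Submodule.span_le]
    rintro x ⟨Z, -, hΘZ, -, u, -, rfl⟩
    exact hraiseval Z hΘZ u
  set M : Submodule ℂ W := U' ⊔ V₀ with hMdef
  -- the `Θ`-commuting elements of `𝔊` preserve `U'`
  have hzeroU' : ∀ Z ∈ 𝔊, Z * Θ = Θ * Z → ∀ u ∈ U', Z u ∈ U' := by
    intro Z hZ hZΘ u hu
    obtain ⟨u₀, hu₀, rfl⟩ := (hU'mem u).1 hu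
    obtain ⟨A, hA, hAZ⟩ := hres Z hZ hZΘ
    exact (hU'mem _).2 ⟨A u₀, hU A hA u₀ hu₀, hAZ u₀⟩
  -- action of `𝔊` on `U'` and on the generators of `V₀`
  have hgen : ∀ Z ∈ 𝔊, Θ * Z = Z → Z * Θ = -Z → ∀ u ∈ U', Z u ∈ M := fun Z hZ h1 h2 u hu =>
    Submodule.mem_sup_right (Submodule.subset_span ⟨Z, hZ, h1, h2, u, hu, rfl⟩)
  have hactU' : ∀ Z ∈ 𝔊, ∀ u ∈ U', Z u ∈ M := by
    intro Z hZ u hu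
    obtain ⟨hZp, hΘZp, hZpΘ⟩ := UnitaryThetaCore.raise_relations hbr hΘ hΘΘ hZ
    obtain ⟨hZm, hΘZm, hZmΘ⟩ := UnitaryThetaCore.lower_relations hbr hΘ hΘΘ hZ
    have hZ0 := UnitaryThetaCore.zero_mem hbr hΘ hΘΘ hZ
    obtain ⟨hdec, hΘZ0⟩ := UnitaryThetaCore.decomp hΘΘ Z
    rw [hdec, LinearMap.add_apply, LinearMap.add_apply]
    refine Submodule.add_mem _ (Submodule.add_mem _ (hgen _ hZp hΘZp hZpΘ u hu) ?_)
      (Submodule.mem_sup_left (hzeroU' _ hZ0 hΘZ0.symm u hu))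
    rw [hlowerQ _ hZmΘ u (hU'Q hu)]
    exact Submodule.zero_mem _
  have hactS : ∀ Z ∈ 𝔊, ∀ x ∈ S, Z x ∈ M := by
    rintro Z hZ x ⟨B, hB, hΘB, hBΘ, u, hu, rfl⟩
    obtain ⟨hZp, hΘZp, hZpΘ⟩ := UnitaryThetaCore.raise_relations hbr hΘ hΘΘ hZ
    obtain ⟨hZm, hΘZm, hZmΘ⟩ := UnitaryThetaCore.lower_relations hbr hΘ hΘΘ hZ
    have hZ0 := UnitaryThetaCore.zero_mem hbr hΘ hΘΘ hZ
    obtain ⟨hdec, hΘZ0⟩ := UnitaryThetaCore.decomp hΘΘ Z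
    set Zp := (4 : ℂ)⁻¹ • (Z + Θ * Z - Z * Θ - Θ * Z * Θ)
    set Zm := (4 : ℂ)⁻¹ • (Z - Θ * Z + Z * Θ - Θ * Z * Θ)
    set Z0 := (2 : ℂ)⁻¹ • (Z + Θ * Z * Θ)
    rw [hdec, LinearMap.add_apply, LinearMap.add_apply]
    refine Submodule.add_mem _ (Submodule.add_mem _ ?_ ?_) ?_
    · -- `Z₊ (B u) = 0`
      rw [hraiseP Zp hZpΘ _ (hraiseval B hΘB u)]
      exact Submodule.zero_mem _
    · -- `Z₋ (B u) = [Z₋, B] u ∈ U'`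
      have hbrk : Zm * B - B * Zm ∈ 𝔊 := hbr _ hZm _ hB
      have hcomm : (Zm * B - B * Zm) * Θ = Θ * (Zm * B - B * Zm) := by
        rw [sub_mul, mul_sub, mul_assoc, hBΘ, mul_assoc, hZmΘ, ← mul_assoc, hΘZm, ← mul_assoc, hΘB, mul_neg,
          neg_mul]
      have heq : Zm (B u) = (Zm * B - B * Zm) u := by
        rw [LinearMap.sub_apply, Module.End.mul_apply, Module.End.mul_apply, hlowerQ Zm hZmΘ u (hU'Q hu), map_zero,
          sub_zero]
      rw [heq]
      exact Submodule.mem_sup_left (hzeroU' _ hbrk hcomm u hu)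
    · -- `Z₀ (B u) = [Z₀, B] u + B (Z₀ u)`
      have hbrk : Z0 * B - B * Z0 ∈ 𝔊 := hbr _ hZ0 _ hB
      have h1 : Θ * (Z0 * B - B * Z0) = Z0 * B - B * Z0 := by
        rw [mul_sub, ← mul_assoc, hΘZ0, mul_assoc, hΘB, ← mul_assoc, hΘB]
      have h2 : (Z0 * B - B * Z0) * Θ = -(Z0 * B - B * Z0) := by
        rw [sub_mul, mul_assoc, hBΘ, mul_assoc, ← hΘZ0, ← mul_assoc, hBΘ, mul_neg, neg_mul, neg_sub_neg, neg_sub]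
      have heq : Z0 (B u) = (Z0 * B - B * Z0) u + B (Z0 u) := by
        rw [LinearMap.sub_apply, Module.End.mul_apply, Module.End.mul_apply, sub_add_cancel]
      rw [heq]
      exact Submodule.add_mem _ (hgen _ hbrk h1 h2 u hu) (hgen B hB hΘB hBΘ _ (hzeroU' _ hZ0 hΘZ0.symm u hu))
  have hactV₀ : ∀ Z ∈ 𝔊, ∀ v ∈ V₀, Z v ∈ M := by
    intro Z hZ v hv
    induction hv using Submodule.span_induction with
    | mem x hx => exact hactS Z hZ x hx
    | zero => rw [map_zero]; exact Submodule.zero_mem _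
    | add x y _ _ hx hy => rw [map_add]; exact Submodule.add_mem _ hx hy
    | smul c x _ hx => rw [map_smul]; exact Submodule.smul_mem _ c hx
  have hM : ∀ Z ∈ 𝔊, ∀ m ∈ M, Z m ∈ M := by
    intro Z hZ m hm
    obtain ⟨u, hu, v, hv, rfl⟩ := Submodule.mem_sup.1 hm
    rw [map_add]
    exact Submodule.add_mem _ (hactU' Z hZ u hu) (hactV₀ Z hZ v hv)
  rcases hirr M hM with h | h
  · left
    rw [eq_bot_iff]
    intro u hu
    rw [Submodule.mem_bot]
    apply Subtype.ext
    have hu' : (u : W) ∈ M := Submodule.mem_sup_left ((hU'mem _).2 ⟨u, hu, rfl⟩)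
    rw [h, Submodule.mem_bot] at hu'
    exact hu'
  · right
    rw [eq_top_iff]
    intro q _
    have hq : (q : W) ∈ M := by rw [h]; exact Submodule.mem_top
    obtain ⟨u, hu, v, hv, huv⟩ := Submodule.mem_sup.1 hq
    have hvQ : v ∈ Q := by
      have hv' : v = (q : W) - u := by rw [← huv]; abel
      rw [hv']
      exact Submodule.sub_mem _ q.2 (hU'Q hu)
    have hv0 : v = 0 := by
      have h1 := (hP v).1 (hV₀P hv)
      rw [(hQ v).1 hvQ, neg_eq_iff_add_eq_zero, ← two_smul ℂ v, smul_eq_zero] at h1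
      exact h1.resolve_left (two_ne_zero' ℂ)
    rw [hv0, add_zero] at huv
    obtain ⟨u₀, hu₀, hu₀u⟩ := (hU'mem u).1 hu
    have : u₀ = q := Subtype.ext (by rw [hu₀u, huv])
    exact this ▸ hu₀

end Levi

/-! ### §6 The theorem -/

section Main

variable {W : Type*} [AddCommGroup W] [Module ℂ W]

/-- **The rank-one criterion without `1 ∈ 𝔊`**: an irreducible bracket-closed `𝔊` containing a rank-one idempotent
`u ⊗ φ` (`φ(u) = 1`) is `End(W)` — `𝔊 + ℂ1 = End(W)` by `SymplecticThetaSix.eq_top_of_rankOne_idempotent`, so `𝔊`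
contains all commutators, and `1 = e + Σᵢ (kᵢ ⊗ κᵢ − e) + Σᵢ e` with `kᵢ ⊗ κᵢ − e = [kᵢ ⊗ φ, u ⊗ κᵢ]` along a basis `kᵢ`
of `ker φ` (the device of `UnitaryThetaCore.eq_top_two_three'`). [cite: Humphreys1972, §19.1] [cite: Ribet1983, Thm. 3] -/
theorem UnitaryTwoOdd.eq_top_of_rankOne [FiniteDimensional ℂ W] {𝔊 : Submodule ℂ (Module.End ℂ W)}
    (hbr : ∀ Y ∈ 𝔊, ∀ Z ∈ 𝔊, Y * Z - Z * Y ∈ 𝔊)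
    (hirr : ∀ U : Submodule ℂ W, (∀ A ∈ 𝔊, ∀ u ∈ U, A u ∈ U) → U = ⊥ ∨ U = ⊤)
    {u : W} {φ : Module.Dual ℂ W} (hφu : φ u = 1) (he : φ.smulRight u ∈ 𝔊) : 𝔊 = ⊤ := by
  classical
  -- `𝔊' = 𝔊 + ℂ·1` is everything
  set 𝔊' : Submodule ℂ (Module.End ℂ W) := 𝔊 ⊔ (ℂ ∙ (1 : Module.End ℂ W)) with h𝔊'
  have hbr_smul : ∀ (Y₁ Z₁ : Module.End ℂ W) (a c : ℂ),
      (Y₁ + a • (1 : Module.End ℂ W)) * (Z₁ + c • 1) - (Z₁ + c • 1) * (Y₁ + a • 1) = Y₁ * Z₁ - Z₁ * Y₁ := by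
    intro Y₁ Z₁ a c
    refine LinearMap.ext fun w => ?_
    simp only [LinearMap.sub_apply, Module.End.mul_apply, LinearMap.add_apply, LinearMap.smul_apply,
      Module.End.one_apply, map_add, map_smul]
    module
  have hdec : ∀ Y ∈ 𝔊', ∃ Y₁ ∈ 𝔊, ∃ a : ℂ, Y = Y₁ + a • 1 := fun Y hY => by
    obtain ⟨Y₁, hY₁, Y₂, hY₂, rfl⟩ := Submodule.mem_sup.1 hY
    obtain ⟨a, rfl⟩ := Submodule.mem_span_singleton.1 hY₂
    exact ⟨Y₁, hY₁, a, rfl⟩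
  have hbr' : ∀ Y ∈ 𝔊', ∀ Z ∈ 𝔊', Y * Z - Z * Y ∈ 𝔊' := by
    intro Y hY Z hZ
    obtain ⟨Y₁, hY₁, a, rfl⟩ := hdec Y hY
    obtain ⟨Z₁, hZ₁, c, rfl⟩ := hdec Z hZ
    rw [hbr_smul]
    exact Submodule.mem_sup_left (hbr Y₁ hY₁ Z₁ hZ₁)
  have hirr' : ∀ U : Submodule ℂ W, (∀ A ∈ 𝔊', ∀ u ∈ U, A u ∈ U) → U = ⊥ ∨ U = ⊤ := fun U hU =>
    hirr U fun A hA v hv => hU A (Submodule.mem_sup_left hA) v hv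
  have htop : 𝔊' = ⊤ :=
    SymplecticThetaSix.eq_top_of_rankOne_idempotent 𝔊' hbr'
      (Submodule.mem_sup_right (Submodule.mem_span_singleton_self _)) hirr' hφu (Submodule.mem_sup_left he)
  -- hence `𝔊` contains all commutators
  have hcomm : ∀ X Y : Module.End ℂ W, X * Y - Y * X ∈ 𝔊 := by
    intro X Y
    obtain ⟨X₁, hX₁, a, rfl⟩ := hdec X (htop ▸ Submodule.mem_top)
    obtain ⟨Y₁, hY₁, c, rfl⟩ := hdec Y (htop ▸ Submodule.mem_top)
    rw [hbr_smul]
    exact hbr X₁ hX₁ Y₁ hY₁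
  -- and `1`
  have h1 : (1 : Module.End ℂ W) ∈ 𝔊 := by
    set K : Submodule ℂ W := LinearMap.ker φ with hKdef
    have hπmem : ∀ w, ((LinearMap.id : Module.End ℂ W) - φ.smulRight u) w ∈ K := fun w => by
      rw [hKdef, LinearMap.mem_ker, LinearMap.sub_apply, LinearMap.id_apply, LinearMap.smulRight_apply, map_sub,
        map_smul, hφu, smul_eq_mul, mul_one, sub_self]
    set π : W →ₗ[ℂ] K := LinearMap.codRestrict K ((LinearMap.id : Module.End ℂ W) - φ.smulRight u) hπmem
      with hπdef
    have hπapply : ∀ w, (π w : W) = w - φ w • u := fun w => rfl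
    set b := Module.finBasis ℂ K with hbdef
    have hsum : ∑ i, ((b.coord i) ∘ₗ π).smulRight (b i : W) = 1 - φ.smulRight u := by
      refine LinearMap.ext fun w => ?_
      rw [LinearMap.sum_apply, LinearMap.sub_apply, Module.End.one_apply, LinearMap.smulRight_apply, ← hπapply]
      simp only [LinearMap.smulRight_apply, LinearMap.comp_apply, Module.Basis.coord_apply]
      have h := congrArg Subtype.val (b.sum_repr (π w))
      simpa only [Submodule.coe_sum, Submodule.coe_smul] using h
    have hterm : ∀ i, ((b.coord i) ∘ₗ π).smulRight (b i : W) - φ.smulRight u ∈ 𝔊 := by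
      intro i
      have hk : φ (b i : W) = 0 := (b i).2
      have hπk : π (b i : W) = b i := by
        apply Subtype.ext
        rw [hπapply, hk, zero_smul, sub_zero]
      have hκk : (b.coord i) (π (b i : W)) = 1 := by
        rw [hπk, Module.Basis.coord_apply, Module.Basis.repr_self, Finsupp.single_eq_same]
      have hid : (φ.smulRight (b i : W)) * (((b.coord i) ∘ₗ π).smulRight u) -
          (((b.coord i) ∘ₗ π).smulRight u) * (φ.smulRight (b i : W)) =
          ((b.coord i) ∘ₗ π).smulRight (b i : W) - φ.smulRight u := by
        refine LinearMap.ext fun w => ?_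
        simp only [LinearMap.sub_apply, Module.End.mul_apply, LinearMap.smulRight_apply, LinearMap.comp_apply,
          map_smul, hφu, hκk, one_smul]
      exact hid ▸ hcomm _ _
    have h1 : (1 : Module.End ℂ W) = φ.smulRight u +
        ∑ i, ((((b.coord i) ∘ₗ π).smulRight (b i : W) - φ.smulRight u) + φ.smulRight u) := by
      simp only [sub_add_cancel]
      rw [hsum, add_sub_cancel]
    rw [h1]
    exact Submodule.add_mem _ he (Submodule.sum_mem _ fun i _ => Submodule.add_mem _ (hterm i) he)
  exact SymplecticThetaSix.eq_top_of_rankOne_idempotent 𝔊 hbr h1 hirr hφu he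

universe u in
/-- The induction behind `UnitaryTwoOdd.eq_top` (strong induction on `dim Q`, the type `W` generalized).
[cite: Ribet1983, Thm. 3] [cite: Gordon1997, §6 (proof of Thm. 6.3.3, pp. 18–19)] -/
private theorem UnitaryTwoOdd.eq_top_aux (b : ℕ) :
    ∀ {W : Type u} [AddCommGroup W] [Module ℂ W] [FiniteDimensional ℂ W]
      {𝔊 : Submodule ℂ (Module.End ℂ W)},
      (∀ Y ∈ 𝔊, ∀ Z ∈ 𝔊, Y * Z - Z * Y ∈ 𝔊) →
      (∀ U : Submodule ℂ W, (∀ A ∈ 𝔊, ∀ u ∈ U, A u ∈ U) → U = ⊥ ∨ U = ⊤) →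
      ∀ {Θ : Module.End ℂ W}, Θ ∈ 𝔊 → Θ * Θ = 1 →
      ∀ {P Q : Submodule ℂ W}, (∀ x, x ∈ P ↔ Θ x = x) → (∀ x, x ∈ Q ↔ Θ x = -x) →
      Module.finrank ℂ P = 2 → Module.finrank ℂ Q = b → Odd b →
      ∀ {s : W → W → ℂ}, (∀ x y z, s (x + y) z = s x z + s y z) →
      (∀ x y, s y x = starRingEnd ℂ (s x y)) →
      (∀ p ∈ P, ∀ q ∈ Q, s p q = 0) → (∀ p ∈ P, s p p = 0 → p = 0) → (∀ q ∈ Q, s q q = 0 → q = 0) →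
      (∀ X ∈ 𝔊, ∃ Y ∈ 𝔊, ∀ x y, s (X x) y = s x (Y y)) → 𝔊 = ⊤ := by
  induction b using Nat.strong_induction_on with
  | _ b ih =>
  intro W _ _ _ 𝔊 hbr hirr Θ hΘ hΘΘ P Q hP hQ hP2 hQb hbodd s hadd hsymm hPQ hdefP hdefQ hadj
  classical
  have hΘΘv : ∀ v, Θ (Θ v) = v := fun v => by rw [← Module.End.mul_apply, hΘΘ, Module.End.one_apply]
  have hPhat : ∀ w, (2 : ℂ)⁻¹ • (w + Θ w) ∈ P := fun w => (hP _).2 (by rw [map_smul, map_add, hΘΘv, add_comm])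
  have hQhat : ∀ w, (2 : ℂ)⁻¹ • (w - Θ w) ∈ Q := fun w =>
    (hQ _).2 (by rw [map_smul, map_sub, hΘΘv, ← smul_neg, neg_sub])
  have hsplit : ∀ w, (2 : ℂ)⁻¹ • (w + Θ w) + (2 : ℂ)⁻¹ • (w - Θ w) = w := fun w => by module
  obtain ⟨-, h0r, h0l, -, -, hsubr, -⟩ := UnitaryTwoOdd.herm_right hadd hsymm
  have hP0 : ∃ p : W, p ≠ 0 ∧ Θ p = p := by
    have hpos : 0 < Module.finrank ℂ P := by rw [hP2]; exact two_pos
    obtain ⟨⟨p, hp⟩, hp0⟩ := Module.finrank_pos_iff_exists_ne_zero.1 hpos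
    exact ⟨p, fun h => hp0 (Subtype.ext h), (hP p).1 hp⟩
  have hraiseval : ∀ Z : Module.End ℂ W, Θ * Z = Z → ∀ w, Z w ∈ P := fun Z hΘZ w =>
    (hP _).2 (by rw [← Module.End.mul_apply, hΘZ])
  -- STEP A: a rank-one idempotent in `𝔊`
  suffices hrank : ∃ (u : W) (φ : Module.Dual ℂ W), φ u = 1 ∧ φ.smulRight u ∈ 𝔊 by
    obtain ⟨u, φ, hφu, he⟩ := hrank
    exact UnitaryTwoOdd.eq_top_of_rankOne hbr hirr hφu he
  rcases Nat.lt_or_ge b 2 with hb | hb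
  · -- `dim Q = 1`: the pair for `−Θ` (multiplicities `(1, 2)`)
    have hb1 : b = 1 := by obtain ⟨k, hk⟩ := hbodd; omega
    rw [hb1] at hQb
    have hQpos : 0 < Module.finrank ℂ Q := by omega
    obtain ⟨⟨q₀, hq₀Q⟩, hq₀0⟩ := Module.finrank_pos_iff_exists_ne_zero.1 hQpos
    have hq₀0' : q₀ ≠ 0 := fun h => hq₀0 (Subtype.ext h)
    have hline : ∀ q ∈ Q, ∃ c : ℂ, c • q₀ = q := fun q hq => by
      obtain ⟨c, hc⟩ := (finrank_eq_one_iff_of_nonzero' (⟨q₀, hq₀Q⟩ : Q) hq₀0).1 hQb ⟨q, hq⟩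
      exact ⟨c, by simpa using congrArg Subtype.val hc⟩
    -- a raising operator not killing `q₀`
    obtain ⟨B, hB, hΘB, hBΘ, hBq₀⟩ : ∃ B ∈ 𝔊, Θ * B = B ∧ B * Θ = -B ∧ B q₀ ≠ 0 := by
      by_contra hne
      push Not at hne
      exact hq₀0' (UnitaryThetaCore.eq_zero_of_forall_raise_apply_eq_zero hbr hirr hΘ hΘΘ hP0
        ((hQ q₀).1 hq₀Q) hne)
    obtain ⟨C, hC, hBC⟩ := hadj B hB
    obtain ⟨hΘC, hCΘ⟩ := UnitaryTwoOdd.lower_of_adjoint hadd hsymm hΘΘ hP hQ hPQ hdefP hdefQ hΘB hBΘ hBC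
    have hnΘ : -Θ ∈ 𝔊 := Submodule.neg_mem _ hΘ
    have hnΘΘ : (-Θ) * (-Θ) = 1 := by rw [neg_mul_neg, hΘΘ]
    refine UnitaryThetaCore.exists_rankOne_idempotent' hbr hnΘ hnΘΘ (P := Q) (Q := P)
      (fun x => by rw [hQ, LinearMap.neg_apply, neg_eq_iff_eq_neg])
      (fun x => by rw [hP, LinearMap.neg_apply, neg_inj]) (by rw [hP2, hQb]) hC hB
      (by rw [neg_mul, hΘC, neg_neg]) (by rw [mul_neg, hCΘ]) (by rw [neg_mul, hΘB]) (by rw [mul_neg, hBΘ, neg_neg])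
      fun q hq hCBq => ?_
    have hBq : B q = 0 := hdefP _ (hraiseval B hΘB q) (by rw [hBC, hCBq, h0r])
    obtain ⟨c, rfl⟩ := hline q hq
    rw [map_smul, smul_eq_zero] at hBq
    rcases hBq with hc | hc
    · rw [hc, zero_smul]
    · exact absurd hc hBq₀
  · -- `dim Q ≥ 2`: the inductive case
    obtain ⟨B, hB, hΘB, hBΘ, honto⟩ :=
      UnitaryTwoOdd.exists_raise_onto hbr hirr hΘ hΘΘ hP hQ hP2 (by rw [hQb]; exact hb)
    obtain ⟨C, hC, hBC⟩ := hadj B hB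
    obtain ⟨hΘC, hCΘ⟩ := UnitaryTwoOdd.lower_of_adjoint hadd hsymm hΘΘ hP hQ hPQ hdefP hdefQ hΘB hBΘ hBC
    have hinj := UnitaryTwoOdd.injOn_of_adjoint hadd hsymm hΘΘ hP hQ hPQ hdefP hdefQ hΘB hBΘ hBC honto
    obtain ⟨E, hE, hEP, hEW, hEK, hECP, hEker, hfinmap, hsup, hinf⟩ :=
      UnitaryTwoOdd.exists_idempotent_of_fullRank_pair hbr hΘ hΘΘ hP hQ hB hC hΘB hBΘ hΘC hCΘ hinj
    set K : Submodule ℂ W := Q ⊓ LinearMap.ker (C * B) with hKdef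
    have hKQ : K ≤ Q := inf_le_left
    have hmapQ : P.map C ≤ Q := le_sup_right.trans hsup.le
    have hCmem : ∀ w, C w ∈ Q := fun w => (hQ _).2 (by rw [← Module.End.mul_apply, hΘC, LinearMap.neg_apply])
    have hEQ : ∀ w, E w ∈ Q := fun w => hKQ (hEW w)
    have hEE : ∀ w, E (E w) = E w := fun w => hEK _ (hEW w)
    have hBK : ∀ k ∈ K, B k = 0 := fun k hk => by
      have hCBk : C (B k) = 0 := by
        have h := LinearMap.mem_ker.1 (Submodule.mem_inf.1 hk).2
        rwa [Module.End.mul_apply] at h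
      exact hdefP _ (hraiseval B hΘB k) (by rw [hBC, hCBk, h0r])
    have hCinj : ∀ p ∈ P, C p = 0 → p = 0 := fun p hp h0 => hinj p hp (by rw [h0, map_zero])
    -- `E` commutes with `Θ`
    have hEΘ : E * Θ = Θ * E := by
      refine LinearMap.ext fun w => ?_
      have hΘw : Θ w = (2 : ℂ)⁻¹ • (w + Θ w) - (2 : ℂ)⁻¹ • (w - Θ w) := by module
      rw [Module.End.mul_apply, Module.End.mul_apply, hΘw, map_sub, hEP _ (hPhat w), zero_sub,
        (hQ _).1 (hEQ w)]
      conv_rhs => rw [← hsplit w, map_add, hEP _ (hPhat w), zero_add]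
    -- dimensions
    have hfinK : Module.finrank ℂ K = b - 2 := by
      have h := Submodule.finrank_sup_add_finrank_inf_eq K (P.map C)
      rw [hsup, hinf, finrank_bot, add_zero, hfinmap, hP2, hQb] at h
      omega
    -- the Levi restriction algebra `𝔩 ⊆ End(Q)`
    set 𝔩 : Submodule ℂ (Module.End ℂ Q) :=
      { carrier := {A | ∃ Z ∈ 𝔊, Z * Θ = Θ * Z ∧ ∀ q : Q, ((A q : Q) : W) = Z q}
        zero_mem' := ⟨0, Submodule.zero_mem _, by rw [zero_mul, mul_zero], fun q => by simp⟩
        add_mem' := by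
          rintro A A' ⟨Z, hZ, hZΘ, hAZ⟩ ⟨Z', hZ', hZ'Θ, hAZ'⟩
          exact ⟨Z + Z', Submodule.add_mem _ hZ hZ', by rw [add_mul, mul_add, hZΘ, hZ'Θ], fun q => by
            rw [LinearMap.add_apply, Submodule.coe_add, hAZ, hAZ', LinearMap.add_apply]⟩
        smul_mem' := by
          rintro c A ⟨Z, hZ, hZΘ, hAZ⟩
          exact ⟨c • Z, Submodule.smul_mem _ c hZ, by rw [smul_mul_assoc, mul_smul_comm, hZΘ], fun q => by
            rw [LinearMap.smul_apply, Submodule.coe_smul, hAZ, LinearMap.smul_apply]⟩ } with h𝔩def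
    have hmem𝔩 : ∀ A, A ∈ 𝔩 ↔ ∃ Z ∈ 𝔊, Z * Θ = Θ * Z ∧ ∀ q : Q, ((A q : Q) : W) = Z q := fun A => Iff.rfl
    have hcommQ : ∀ Z : Module.End ℂ W, Z * Θ = Θ * Z → ∀ q ∈ Q, Z q ∈ Q := fun Z hZ q hq =>
      (hQ _).2 (by rw [← Module.End.mul_apply, ← hZ, Module.End.mul_apply, (hQ q).1 hq, map_neg])
    have hcommP : ∀ Z : Module.End ℂ W, Z * Θ = Θ * Z → ∀ p ∈ P, Z p ∈ P := fun Z hZ p hp =>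
      (hP _).2 (by rw [← Module.End.mul_apply, ← hZ, Module.End.mul_apply, (hP p).1 hp])
    have hres : ∀ Z ∈ 𝔊, Z * Θ = Θ * Z → ∃ A ∈ 𝔩, ∀ q : Q, ((A q : Q) : W) = Z q := fun Z hZ hZΘ =>
      ⟨Z.restrict fun q hq => hcommQ Z hZΘ q hq, ⟨Z, hZ, hZΘ, fun q => rfl⟩, fun q => rfl⟩
    have hbr𝔩 : ∀ A ∈ 𝔩, ∀ A' ∈ 𝔩, A * A' - A' * A ∈ 𝔩 := by
      intro A hA A' hA'
      obtain ⟨Z, hZ, hZΘ, hAZ⟩ := (hmem𝔩 A).1 hA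
      obtain ⟨Z', hZ', hZ'Θ, hAZ'⟩ := (hmem𝔩 A').1 hA'
      refine (hmem𝔩 _).2 ⟨Z * Z' - Z' * Z, hbr Z hZ Z' hZ', ?_, fun q => ?_⟩
      · rw [sub_mul, mul_sub, mul_assoc, hZ'Θ, ← mul_assoc, hZΘ, mul_assoc, mul_assoc, hZΘ, ← mul_assoc Z', hZ'Θ,
          mul_assoc]
      · rw [LinearMap.sub_apply, Submodule.coe_sub, Module.End.mul_apply, Module.End.mul_apply, hAZ, hAZ', hAZ',
          hAZ, LinearMap.sub_apply, Module.End.mul_apply, Module.End.mul_apply]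
    have hirr𝔩 := UnitaryTwoOdd.levi_irreducible hbr hirr hΘ hΘΘ hP hQ 𝔩 hres
    -- the idempotent `f = E|_Q` and the involution `T = 1 − 2f`
    set f : Module.End ℂ Q := E.restrict fun q (_ : q ∈ Q) => hEQ q with hfdef
    have hfapply : ∀ q : Q, ((f q : Q) : W) = E q := fun q => rfl
    have hff : f * f = f := LinearMap.ext fun q => Subtype.ext (by
      rw [Module.End.mul_apply, hfapply, hfapply, hEE])
    set T : Module.End ℂ Q := 1 - (f + f) with hTdef
    have hTapply : ∀ q : Q, ((T q : Q) : W) = (q : W) - (E q + E q) := fun q => by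
      rw [hTdef, LinearMap.sub_apply, Module.End.one_apply, LinearMap.add_apply, Submodule.coe_sub,
        Submodule.coe_add, hfapply]
    have hT𝔩 : T ∈ 𝔩 := by
      refine (hmem𝔩 T).2 ⟨-Θ - (E + E), Submodule.sub_mem _ (Submodule.neg_mem _ hΘ) (Submodule.add_mem _ hE hE),
        ?_, fun q => ?_⟩
      · rw [sub_mul, mul_sub, add_mul, mul_add, hEΘ, neg_mul, mul_neg]
      · rw [hTapply, LinearMap.sub_apply, LinearMap.neg_apply, LinearMap.add_apply, (hQ _).1 q.2, neg_neg]
    have hTT : T * T = 1 := LinearMap.ext fun q => Subtype.ext (by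
      rw [Module.End.mul_apply, Module.End.one_apply, hTapply, hTapply, map_sub, map_add, hEE]
      abel)
    -- its eigenspaces `P' = ker f` (`= C(P)`) and `Q' = range f` (`= K`)
    set P' : Submodule ℂ Q := LinearMap.ker f with hP'def
    set Q' : Submodule ℂ Q := LinearMap.range f with hQ'def
    have hP' : ∀ x, x ∈ P' ↔ T x = x := fun x => by
      rw [hP'def, LinearMap.mem_ker]
      constructor
      · intro h
        apply Subtype.ext
        rw [hTapply, ← hfapply, h, Submodule.coe_zero, add_zero, sub_zero]
      · intro h
        have h' := congrArg Subtype.val h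
        rw [hTapply, sub_eq_self, ← two_smul ℂ, smul_eq_zero] at h'
        exact Subtype.ext (by rw [hfapply]; exact h'.resolve_left two_ne_zero)
    have hQ'mem : ∀ x : Q, x ∈ Q' ↔ E x = x := fun x => by
      rw [hQ'def, LinearMap.mem_range]
      constructor
      · rintro ⟨y, rfl⟩
        rw [hfapply, hEE]
      · intro h
        exact ⟨x, Subtype.ext (by rw [hfapply, h])⟩
    have hQ' : ∀ x, x ∈ Q' ↔ T x = -x := fun x => by
      rw [hQ'mem]
      constructor
      · intro h
        apply Subtype.ext
        rw [hTapply, h, Submodule.coe_neg]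
        abel
      · intro h
        have h' := congrArg Subtype.val h
        rw [hTapply, Submodule.coe_neg] at h'
        have h3 := eq_neg_iff_add_eq_zero.1 h'
        have h2 : E x + E x = (x : W) + x := by
          rw [← sub_eq_zero, ← neg_eq_zero, ← h3]; abel
        rw [← two_smul ℂ (E (x : W)), ← two_smul ℂ (x : W)] at h2
        exact smul_right_injective W (two_ne_zero' ℂ) h2
    have hP'eq : P' = Submodule.comap Q.subtype (P.map C) := by
      ext x
      rw [hP'def, LinearMap.mem_ker, Submodule.mem_comap, Submodule.subtype_apply]
      constructor
      · intro h
        exact hEker x x.2 (by rw [← hfapply, h, Submodule.coe_zero])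
      · rintro ⟨p, hp, hpx⟩
        apply Subtype.ext
        rw [hfapply, Submodule.coe_zero, ← hpx, hECP p hp]
    have hQ'eq : Q' = Submodule.comap Q.subtype K := by
      ext x
      rw [hQ'mem, Submodule.mem_comap, Submodule.subtype_apply]
      constructor
      · intro h
        rw [← h]; exact hEW x
      · intro h
        exact hEK x h
    have hfinP' : Module.finrank ℂ P' = 2 := by
      rw [hP'eq, (Submodule.comapSubtypeEquivOfLe hmapQ).finrank_eq, hfinmap, hP2]
    have hfinQ' : Module.finrank ℂ Q' = b - 2 := by
      rw [hQ'eq, (Submodule.comapSubtypeEquivOfLe hKQ).finrank_eq, hfinK]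
    -- the Hermitian data on `Q`
    have hP'Q' : ∀ p' ∈ P', ∀ q' ∈ Q', s (p' : W) q' = 0 := by
      intro p' hp' q' hq'
      rw [hP'eq] at hp'
      obtain ⟨p, hp, hpp'⟩ := hp'
      rw [hQ'eq] at hq'
      have hBq' : B q' = 0 := hBK _ hq'
      rw [Submodule.subtype_apply] at hpp'
      rw [← hpp', hsymm, ← hBC, hBq', h0l, map_zero]
    have hadj𝔩 : ∀ A ∈ 𝔩, ∃ A' ∈ 𝔩, ∀ x y : Q, s ((A x : Q) : W) y = s x ((A' y : Q) : W) := by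
      intro A hA
      obtain ⟨Z, hZ, hZΘ, hAZ⟩ := (hmem𝔩 A).1 hA
      obtain ⟨Z', hZ', hZZ'⟩ := hadj Z hZ
      have hΘs := UnitaryTwoOdd.theta_selfAdjoint hadd hsymm hΘΘ hP hQ hPQ
      have hZ'Θ : Z' * Θ = Θ * Z' := by
        refine LinearMap.ext fun y => ?_
        rw [← sub_eq_zero, ← LinearMap.sub_apply]
        refine UnitaryTwoOdd.eq_zero_of_forall_left hadd hsymm hΘΘ hP hQ hPQ hdefP hdefQ fun x => ?_
        rw [LinearMap.sub_apply, hsubr, Module.End.mul_apply, Module.End.mul_apply, ← hZZ', ← hΘs, ← hΘs, ← hZZ',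
          ← Module.End.mul_apply, ← Module.End.mul_apply, hZΘ, sub_self]
      obtain ⟨A', hA', hA'Z'⟩ := hres Z' hZ' hZ'Θ
      exact ⟨A', hA', fun x y => by rw [hAZ, hA'Z', hZZ']⟩
    -- induction: `𝔩 = End(Q)`
    have hb2 : b - 2 < b := by omega
    have hbodd' : Odd (b - 2) := by obtain ⟨k, hk⟩ := hbodd; exact ⟨k - 1, by omega⟩
    have h𝔩top : 𝔩 = ⊤ :=
      ih (b - 2) hb2 hbr𝔩 hirr𝔩 hT𝔩 hTT hP' hQ' hfinP' hfinQ' hbodd' (s := fun x y : Q => s (x : W) y)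
        (fun x y z => by simp only [Submodule.coe_add, hadd]) (fun x y => hsymm x y) hP'Q'
        (fun p _ h => Subtype.ext (hdefQ _ p.2 h)) (fun q _ h => Subtype.ext (hdefQ _ q.2 h)) hadj𝔩
    -- the `𝔑`-trick
    set 𝔑 : Submodule ℂ (Module.End ℂ Q) :=
      { carrier := {Y | ∃ N ∈ 𝔊, (∀ p ∈ P, N p = 0) ∧ ∀ q : Q, ((Y q : Q) : W) = N q}
        zero_mem' := ⟨0, Submodule.zero_mem _, fun p _ => rfl, fun q => by simp⟩
        add_mem' := by
          rintro Y Y' ⟨N, hN, hNP, hYN⟩ ⟨N', hN', hN'P, hYN'⟩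
          exact ⟨N + N', Submodule.add_mem _ hN hN', fun p hp => by
            rw [LinearMap.add_apply, hNP p hp, hN'P p hp, add_zero], fun q => by
            rw [LinearMap.add_apply, Submodule.coe_add, hYN, hYN', LinearMap.add_apply]⟩
        smul_mem' := by
          rintro c Y ⟨N, hN, hNP, hYN⟩
          exact ⟨c • N, Submodule.smul_mem _ c hN, fun p hp => by rw [LinearMap.smul_apply, hNP p hp, smul_zero],
            fun q => by rw [LinearMap.smul_apply, Submodule.coe_smul, hYN, LinearMap.smul_apply]⟩ } with h𝔑def
    have hmem𝔑 : ∀ Y, Y ∈ 𝔑 ↔ ∃ N ∈ 𝔊, (∀ p ∈ P, N p = 0) ∧ ∀ q : Q, ((Y q : Q) : W) = N q := fun Y => Iff.rfl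
    have hf𝔑 : f ∈ 𝔑 := (hmem𝔑 f).2 ⟨E, hE, hEP, hfapply⟩
    have had : ∀ A : Module.End ℂ Q, ∀ Y ∈ 𝔑, A * Y - Y * A ∈ 𝔑 := by
      intro A Y hY
      obtain ⟨Z, hZ, hZΘ, hAZ⟩ := (hmem𝔩 A).1 (h𝔩top ▸ Submodule.mem_top)
      obtain ⟨N, hN, hNP, hYN⟩ := (hmem𝔑 Y).1 hY
      refine (hmem𝔑 _).2 ⟨Z * N - N * Z, hbr Z hZ N hN, fun p hp => ?_, fun q => ?_⟩
      · rw [LinearMap.sub_apply, Module.End.mul_apply, Module.End.mul_apply, hNP p hp, map_zero,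
          hNP _ (hcommP Z hZΘ p hp), sub_zero]
      · rw [LinearMap.sub_apply, Submodule.coe_sub, Module.End.mul_apply, Module.End.mul_apply, hAZ, hYN, hYN, hAZ,
          LinearMap.sub_apply, Module.End.mul_apply, Module.End.mul_apply]
    have hf0 : f ≠ 0 := by
      have hKpos : 0 < Module.finrank ℂ K := by rw [hfinK]; obtain ⟨k, hk⟩ := hbodd; omega
      obtain ⟨⟨k, hk⟩, hk0⟩ := Module.finrank_pos_iff_exists_ne_zero.1 hKpos
      intro hf
      apply hk0
      apply Subtype.ext
      have h := hfapply ⟨k, hKQ hk⟩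
      rw [hf, LinearMap.zero_apply, Submodule.coe_zero, hEK k hk] at h
      exact h.symm
    have hf1 : f ≠ 1 := by
      obtain ⟨p₀, hp₀0, hp₀⟩ := hP0
      have hp₀P : p₀ ∈ P := (hP p₀).2 hp₀
      intro hf
      have h := hfapply ⟨C p₀, hCmem p₀⟩
      rw [hf, Module.End.one_apply, hECP p₀ hp₀P] at h
      exact hp₀0 (hCinj p₀ hp₀P h)
    obtain ⟨u, φ, hφu, hφ𝔑⟩ := UnitaryTwoOdd.exists_rankOne_of_adStable 𝔑 had hf𝔑 hff hf0 hf1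
    obtain ⟨N, hN, hNP, hNq⟩ := (hmem𝔑 _).1 hφ𝔑
    -- `N = (φ ∘ π_Q) ⊗ u` is a rank-one idempotent of `W` in `𝔊`
    set πQ : W →ₗ[ℂ] Q := LinearMap.codRestrict Q ((2 : ℂ)⁻¹ • ((1 : Module.End ℂ W) - Θ)) fun w => by
      rw [LinearMap.smul_apply, LinearMap.sub_apply, Module.End.one_apply]; exact hQhat w with hπQdef
    have hπapply : ∀ w, (πQ w : W) = (2 : ℂ)⁻¹ • (w - Θ w) := fun w => rfl
    have hπq : ∀ q : Q, πQ q = q := fun q => Subtype.ext (by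
      rw [hπapply, (hQ _).1 q.2, sub_neg_eq_add, ← two_smul ℂ (q : W), smul_smul, inv_mul_cancel₀ two_ne_zero,
        one_smul])
    refine ⟨u, φ ∘ₗ πQ, by rw [LinearMap.comp_apply, hπq, hφu], ?_⟩
    have hNeq : (φ ∘ₗ πQ).smulRight (u : W) = N := by
      refine LinearMap.ext fun w => ?_
      rw [LinearMap.smulRight_apply, LinearMap.comp_apply]
      conv_rhs => rw [← hsplit w, map_add, hNP _ (hPhat w), zero_add]
      have h := hNq (πQ w)
      rw [LinearMap.smulRight_apply, Submodule.coe_smul] at h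
      rw [h, hπapply]
    rw [hNeq]
    exact hN

/-- **THE `Θ`-SUBALGEBRA THEOREM FOR UNITARY MULTIPLICITIES `(2, b)`, `b` ODD — complex Hermitian core.** Let
`𝔊 ⊆ End(W)` be bracket-closed and act irreducibly, `Θ ∈ 𝔊` an involution with eigenspaces `P` (`dim P = 2`) and `Q`
(`dim Q` odd), and let `s` be a Hermitian function on `W`, additive in the first variable, with `P ⊥ Q`, `s(x,x) ≠ 0` for
non-zero `x` in `P` and in `Q`, such that every element of `𝔊` has an `s`-adjoint in `𝔊`. Then `𝔊 = End(W)`. This is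
the classification-free replacement of Serre's lemma in Ribet's Theorem 3 at `(n′, n″) = (2, n″)`, `n″` odd (the tree's
`UnitaryThetaCore.eq_top_two_three'` is the case `n″ = 3` without the Hermitian hypothesis).
[cite: Ribet1983, Thm. 3] [cite: Gordon1997, Thm. 6.3 (3) and pp. 18–19] [cite: Deligne1982HodgeCycles, I §3 Prop. 3.4, 3.6]
[cite: MoonenZarhin1999LowDim, §2 (2.4) and Thm. (2.7)] -/
theorem UnitaryTwoOdd.eq_top [FiniteDimensional ℂ W] {𝔊 : Submodule ℂ (Module.End ℂ W)}
    (hbr : ∀ Y ∈ 𝔊, ∀ Z ∈ 𝔊, Y * Z - Z * Y ∈ 𝔊)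
    (hirr : ∀ U : Submodule ℂ W, (∀ A ∈ 𝔊, ∀ u ∈ U, A u ∈ U) → U = ⊥ ∨ U = ⊤)
    {Θ : Module.End ℂ W} (hΘ : Θ ∈ 𝔊) (hΘΘ : Θ * Θ = 1)
    {P Q : Submodule ℂ W} (hP : ∀ x, x ∈ P ↔ Θ x = x) (hQ : ∀ x, x ∈ Q ↔ Θ x = -x)
    (hP2 : Module.finrank ℂ P = 2) (hQodd : Odd (Module.finrank ℂ Q))
    {s : W → W → ℂ} (hadd : ∀ x y z, s (x + y) z = s x z + s y z) (hsymm : ∀ x y, s y x = starRingEnd ℂ (s x y))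
    (hPQ : ∀ p ∈ P, ∀ q ∈ Q, s p q = 0) (hdefP : ∀ p ∈ P, s p p = 0 → p = 0) (hdefQ : ∀ q ∈ Q, s q q = 0 → q = 0)
    (hadj : ∀ X ∈ 𝔊, ∃ Y ∈ 𝔊, ∀ x y, s (X x) y = s x (Y y)) : 𝔊 = ⊤ :=
  UnitaryTwoOdd.eq_top_aux _ hbr hirr hΘ hΘΘ hP hQ hP2 rfl hQodd hadd hsymm hPQ hdefP hdefQ hadj

/-- **The symmetric statement: `dim P` odd, `dim Q = 2`** (apply `eq_top` to `−Θ`).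
[cite: Ribet1983, Thm. 3] [cite: Gordon1997, Thm. 6.3 (3)] -/
theorem UnitaryTwoOdd.eq_top' [FiniteDimensional ℂ W] {𝔊 : Submodule ℂ (Module.End ℂ W)}
    (hbr : ∀ Y ∈ 𝔊, ∀ Z ∈ 𝔊, Y * Z - Z * Y ∈ 𝔊)
    (hirr : ∀ U : Submodule ℂ W, (∀ A ∈ 𝔊, ∀ u ∈ U, A u ∈ U) → U = ⊥ ∨ U = ⊤)
    {Θ : Module.End ℂ W} (hΘ : Θ ∈ 𝔊) (hΘΘ : Θ * Θ = 1)
    {P Q : Submodule ℂ W} (hP : ∀ x, x ∈ P ↔ Θ x = x) (hQ : ∀ x, x ∈ Q ↔ Θ x = -x)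
    (hPodd : Odd (Module.finrank ℂ P)) (hQ2 : Module.finrank ℂ Q = 2)
    {s : W → W → ℂ} (hadd : ∀ x y z, s (x + y) z = s x z + s y z) (hsymm : ∀ x y, s y x = starRingEnd ℂ (s x y))
    (hPQ : ∀ p ∈ P, ∀ q ∈ Q, s p q = 0) (hdefP : ∀ p ∈ P, s p p = 0 → p = 0) (hdefQ : ∀ q ∈ Q, s q q = 0 → q = 0)
    (hadj : ∀ X ∈ 𝔊, ∃ Y ∈ 𝔊, ∀ x y, s (X x) y = s x (Y y)) : 𝔊 = ⊤ := by
  have hnΘ : -Θ ∈ 𝔊 := Submodule.neg_mem _ hΘ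
  have hnΘΘ : (-Θ) * (-Θ) = 1 := by rw [neg_mul_neg, hΘΘ]
  exact UnitaryTwoOdd.eq_top hbr hirr hnΘ hnΘΘ (P := Q) (Q := P)
    (fun x => by rw [hQ, LinearMap.neg_apply, neg_eq_iff_eq_neg]) (fun x => by rw [hP, LinearMap.neg_apply, neg_inj])
    hQ2 hPodd hadd hsymm (fun q hq p hp => by rw [hsymm, hPQ p hp q hq, map_zero]) hdefQ hdefP hadj

end Main

end HodgeStructure

end Literature.AlgebraicGeometry.Motives

end
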